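import Literature.AlgebraicGeometry.Motives.HodgeThetaSubalgebraSymplecticRankFour
import HarnessLib

/-!
# The `Θ`-subalgebra theorem in rank six (Moonen–Zarhin 1999 (2.3), Type I(1), `g = 3`:
# `Hg(X) = Sp(V, φ) ≅ Sp_{6,ℚ}`) — the complex core: Siegel grading, the irreducible Levi line algebra, and the
# rank-one criterion

Family `hodge`, layer `Literature/AlgebraicGeometry/Motives`. Research context: cell `pub-hodge-ring2` (HONEST
FRAMING: research route conditional on HC_CM; not a corollary; Q11.4-sentence-2 already refuted in dim ≥ 3),
Literature lane, programme R13 «generic abelian threefolds», the abstract Lie step, PART 1. UNCONDITIONAL linear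
algebra over `ℂ`; theorems only, no definition, no named fact (D-0026), no `sorry`. Sequel of
`HodgeThetaSubalgebraSymplecticRankFour` (R11-1), whose grading lemma `SymplecticTheta.exists_decomp` and
symmetrised pairing `SymplecticTheta.form_commutator_apply` are reused.

THE PRINTED THEOREM. B. Moonen, Yu. Zarhin, *Hodge classes on abelian varieties of low dimension*, Math. Ann.
315 (1999) 711–733 [`paper:arxiv-math_9901113`, held], §2 p. 715 (p0005 L19–L22): "For `g := dim(X) ≤ 3` and
`g = 5` we always find that `Hg(X) = Sp_D(V,φ)`. […] it follows that `B(Xⁿ) = D(Xⁿ)` for all `n`."; (2.3)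
(p0005 L84–L86): "`g = 3`. […] Type 1(1): `X` is an abelian 3-fold with `End⁰(X) = ℚ`. Then
`Hg(X) = Sp(V,φ) ≅ Sp_{6,ℚ}`."

WHY RANK SIX IS DIFFERENT. In rank four (R11-1, `SymplecticTheta.core_of_irreducible`) EVERY bracket-closed space
`𝔊 ⊆ 𝔰𝔭(M, ω)` acting irreducibly and containing the Hodge involution `T` (`±1`-eigenspaces `P`, `Q` Lagrangian
planes) is all of `𝔰𝔭(M, ω)`. In rank six this is false over `ℂ`: `𝔰𝔩₂ ⊗ 1 ⊕ 1 ⊗ 𝔰𝔬₃` acting on `ℂ² ⊗ ℂ³` with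
`T = h ⊗ 1` is irreducible (it is the complexified Hodge Lie algebra of `E³` enlarged by the compact `SO₃` of the
multiplicity space — Moonen–Zarhin (2.5): multiplicities, and Mumford's examples in rank eight, (2.4) (1)). The
exclusion of this alternative needs the `ℚ`-structure (`End_Hdg(V) = ℚ`, sequel PART 2); the present file proves
the complex-linear mechanism that reduces everything to ONE criterion: a RANK-ONE element in `𝔊₊` or `𝔊₋`.

WHAT IS PROVED (data: `ω` nondegenerate alternating on a complex space `M`; `𝔊 ⊆ End(M)` bracket-closed, `ω`-skew,
containing an involution `T` with eigenspaces `P` (`+1`), `Q` (`−1`); `M` without `𝔊`-stable subspaces other than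
`0`, `M`; Siegel grading `𝔊 = 𝔊₋ ⊕ 𝔊₀ ⊕ 𝔊₊` by `ad T`, `𝔊₊ = {B : B(P) = 0, B(M) ⊆ P}`, `𝔊₋` symmetrically,
`𝔊₀` preserving `P` and `Q`; `𝔩 ⊆ End(P)` the Lie algebra of restrictions of `𝔊₀`, `1 = T|_P ∈ 𝔩`).
* §1 `SymplecticThetaSix.eq_bot_or_eq_of_stable_le` — THE ORBIT LEMMA in any rank: a subspace `U ⊆ P` stable under
  `𝔊₀` is `0` or `P` (the orbit `U ⊕ 𝔊₋U` is `𝔊`-stable and its `P`-component lies in `U`); hence `𝔩` acts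
  irreducibly on `P` (`SymplecticThetaSix.levi_irreducible`). (R11-1 proved the case of a line in a plane.)
* §2 `SymplecticThetaSix.eq_top_of_rankOne_idempotent` — THE RANK-ONE CRITERION FOR `𝔩` (any dimension): a
  bracket-closed `𝔩 ⊆ End(W)` containing `1` and a rank-one idempotent `e = u ⊗ φ` (`φ(u) = 1`) and acting
  irreducibly on `W` is all of `End(W)`: grading by the involution `2e − 1`; the lines `K₁ = {k : k ⊗ φ ∈ 𝔩}` and
  the co-lines `{ψ : u ⊗ ψ ∈ 𝔩}` fill `ker φ` and `u^⊥` by irreducibility (orbits `ℂu ⊕ K₁` and the joint kernel),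
  and `k ⊗ ψ = [k ⊗ φ, u ⊗ ψ] + ψ(k) e`. (Jacobson's density for Lie algebras of linear transformations containing
  a rank-one projection; Goodman–Wallach §2.1.2/§4.1.1 for the block form.)
* §3 `SymplecticThetaSix.plus_mem_of_levi` — THE UNIPOTENT RADICAL FROM THE LEVI: if every endomorphism of
  `P` is the restriction of an element of `𝔊` preserving `P` and `Q`, and `𝔊₊ ∋ B₀ ≠ 0`, then `𝔊₊` is ALL of
  `𝔲⁺ = {Y skew : Y(P) = 0, Y(M) ⊆ P}`: a vector `ξ ∈ Q` with `ω(B₀ξ, ξ) ≠ 0`, the Levi element `Z` restricting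
  to `p ↦ ω(p, ξ)a`, `[Z,[Z,B₀]] − [Z,B₀] = 2ω(B₀ξ,ξ) · ω(a,−)a`; then all symmetrised products
  `ω(d,−)c + ω(c,−)d` by two brackets, and `Y = ½ Σ ω(Yq_i, q_j) B_{b_j b_i}` along a basis `b` of `P` and its
  `ω`-dual family `q` in `Q` (`exists_dual_family`, which also gives `dim P = dim Q`).
* §4 `SymplecticThetaSix.core_of_rankOne` — THE CORE THEOREM, RANK-ONE FORM (any rank): if some `Z ∈ 𝔊`
  preserving `P` restricts to `P` as a rank-one idempotent `p ↦ ω(p, ξ) a` (`ω(a, ξ) = 1`), then `𝔊` contains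
  `𝔲⁺`, the Levi `𝔤𝔩(P)` and `𝔲⁻` — `𝔊 = 𝔰𝔭(M, ω)`: §1 + §2 give `𝔩 = End(P)`, the Levi is realised by
  `𝔊₀`-components, `𝔊₊ ≠ 0 ≠ 𝔊₋` (else `Q` or `P` is stable), §3 for `(P, Q, T)` and for `(Q, P, −T)` (there
  `−Z` restricts to `Q` as the idempotent `η ↦ ω(η, −a) ξ`).
* §5 `SymplecticThetaSix.exists_rankOne_polynomial` — THE SPECTRAL LEMMA in dimension three: an operator `X`
  with two distinct eigenvalues has a polynomial `c₀ + c₁X + c₂X²` which is a rank-one idempotent `u ⊗ φ`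
  (case analysis on `E = (X − μ₁)(X − μ₂)`: `E = 0` and an eigenline; `E ≠ 0` of rank one with image an
  eigenline for `ν ∉ {μ₁, μ₂}`, `ν = μ₁` or `ν = μ₂`); and `SymplecticThetaSix.core_of_twoEigenvalues` — THE CORE
  THEOREM, TWO-EIGENVALUE FORM: if `dim P = 3` and for some `B ∈ 𝔊₊`, `C ∈ 𝔊` the product `BC|_P` has two
  distinct eigenvalues, then `𝔊 = 𝔰𝔭(M, ω)` (`[B,C]`, `[BCB, C]` realise `X`, `X²`; `BCB = ½[[B,C],B]`).

NOT here (sequel, PART 2): the complementary case in which EVERY product `BC|_P` (`B ∈ 𝔊₊`, `C ∈ 𝔊₋`) has a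
single eigenvalue — its reduction to the E³-type alternative (`𝔊₊ = ℂB₊`, `𝔊₋ = ℂC₋`, `𝔊₀ = ℂT ⊕ 𝔷(B₊)`;
Jordan closure of `𝔊₊C|_P`, Cartan's solvability criterion for the all-nilpotent corner) and the arithmetic
exclusion of that alternative under `End_Hdg(V) = ℚ` (Killing form of `𝔤` versus trace form of `V`: `3κ = 4β` on
the `𝔰𝔩₂`-ideal only); Theorem L-Sp in rank six; abelian threefolds (MZ99 (2.3): `B(Xⁿ) = D(Xⁿ)` for all `n`).

## References

* [MoonenZarhin1999LowDim] B. Moonen, Yu. Zarhin, Hodge classes on abelian varieties of low dimension, Math.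
  Ann. 315 (1999) 711–733 = arXiv:math/9901113, §1 (1.8), §2 p. 715, (2.3) Type I(1), (2.4) (1), (2.5).
* [Gordon1997] B. B. Gordon, A survey of the Hodge conjecture for abelian varieties, arXiv:alg-geom/9709030,
  §1.6.2 (Lie algebras of Hodge groups), §6 (proof of Thm. 6.3.3, p. 19), Thm. 7.5 (Murty / Hazama).
* [GoodmanWallachGTM255] R. Goodman, N. R. Wallach, GTM 255 (2009), §2.1.2 (`𝔰𝔭` in block form), §4.1.1
  (Burnside / double commutant), Thm. 5.3.3.
* [Humphreys1972] J. E. Humphreys, Introduction to Lie Algebras and Representation Theory (1972), §4.1, §19.1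
  (irreducible linear Lie algebras).
* [Deligne1982HodgeCycles] P. Deligne, Hodge cycles on abelian varieties, LNM 900 (1982), I §3 Prop. 3.4.
* [vanGeemen1994HodgeAV] B. van Geemen, An introduction to the Hodge conjecture for abelian varieties, LNM
  1594 (1994), Thm. 4.2 (Mattuck: general abelian varieties), §2.4–2.5.
-/

noncomputable section

open scoped TensorProduct

namespace Literature.AlgebraicGeometry.Motives

namespace HodgeStructure

/-! ### §1 The orbit lemma: a `𝔊₀`-stable subspace of `P` is `0` or `P` -/

section Orbit

variable {M : Type*} [AddCommGroup M] [Module ℂ M]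

/-- **The orbit lemma (any rank).** Let `𝔊 ⊆ End(M)` be bracket-closed and contain an involution `T` with
eigenspaces `P` (`+1`) and `Q` (`−1`), and suppose `M` has no `𝔊`-stable subspace other than `0` and `M`. Then a
subspace `U ⊆ P` stable under every element of `𝔊` preserving `P` (the Levi part `𝔊₀`) is `0` or `P`. Proof: the
orbit `U' = U + Σ_{C ∈ 𝔊₋} C U` is `𝔊`-stable — for `Z = Z₋ + Z₀ + Z₊` (`SymplecticTheta.exists_decomp`):
`Z u = Z₋ u + Z₀ u`, `Z(Cu) = [Z₀, C]u + C(Z₀ u) + [Z₊, C]u` with `[Z₀, C] ∈ 𝔊₋`, `[Z₊, C] ∈ 𝔊₀` — and the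
`P`-components `½(1 + T)U'` lie in `U`; so `U' = M` forces `U = P`. (Gordon §6, proof of Thm. 6.3.3: the orbit
of a highest weight line; R11-1 `core_of_irreducible`, the line case.)
[cite: Gordon1997, §6 (proof of Thm. 6.3.3, p. 19)] [cite: GoodmanWallachGTM255, §2.1.2] -/
theorem SymplecticThetaSix.eq_bot_or_eq_of_stable_le (𝔊 : Submodule ℂ (Module.End ℂ M))
    (hbr : ∀ Y ∈ 𝔊, ∀ Z ∈ 𝔊, Y * Z - Z * Y ∈ 𝔊) {T : Module.End ℂ M} (hT𝔊 : T ∈ 𝔊) (hTT : ∀ v, T (T v) = v)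
    {P Q : Submodule ℂ M} (hP : ∀ x ∈ P, T x = x) (hQ : ∀ x ∈ Q, T x = -x)
    (hPmem : ∀ v, (2 : ℂ)⁻¹ • (v + T v) ∈ P) (hQmem : ∀ v, (2 : ℂ)⁻¹ • (v - T v) ∈ Q)
    (hirr : ∀ U : Submodule ℂ M, (∀ Z ∈ 𝔊, ∀ u ∈ U, Z u ∈ U) → U = ⊥ ∨ U = ⊤)
    (U : Submodule ℂ M) (hUP : U ≤ P) (hU : ∀ Z ∈ 𝔊, (∀ p ∈ P, Z p ∈ P) → ∀ u ∈ U, Z u ∈ U) :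
    U = ⊥ ∨ U = P := by
  classical
  have hdec := fun Z (hZ : Z ∈ 𝔊) => SymplecticTheta.exists_decomp 𝔊 hbr hT𝔊 hTT hP hQ hPmem hQmem hZ
  -- the orbit `U' = U + span {C u}`
  set S : Set M := {x | ∃ C ∈ 𝔊, (∀ q ∈ Q, C q = 0) ∧ (∀ v, C v ∈ Q) ∧ ∃ u ∈ U, x = C u} with hS
  set U' : Submodule ℂ M := U ⊔ Submodule.span ℂ S with hU'
  have hUU' : U ≤ U' := le_sup_left
  have hSU' : ∀ C ∈ 𝔊, (∀ q ∈ Q, C q = 0) → (∀ v, C v ∈ Q) → ∀ u ∈ U, C u ∈ U' :=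
    fun C hC h1 h2 u hu => le_sup_right (b := Submodule.span ℂ S)
      (Submodule.subset_span ⟨C, hC, h1, h2, u, hu, rfl⟩)
  have hU'stab : ∀ Z ∈ 𝔊, ∀ x ∈ U', Z x ∈ U' := by
    intro Z hZ x hx
    obtain ⟨Zm, hZm, Z0, hZ0, Zp, hZp, hZeq, hZpP, hZpim, hZmQ, hZmim, -, -, hZ0P, hZ0Q⟩ := hdec Z hZ
    rw [Submodule.mem_sup] at hx
    obtain ⟨u, hu, s, hs, rfl⟩ := hx
    rw [map_add]
    refine Submodule.add_mem _ ?_ ?_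
    · -- `Z u = Z₋ u + Z₀ u + 0`
      rw [hZeq, LinearMap.add_apply, LinearMap.add_apply, hZpP _ (hUP hu), add_zero]
      exact Submodule.add_mem _ (hSU' Zm hZm hZmQ hZmim u hu) (hUU' (hU Z0 hZ0 hZ0P u hu))
    · induction hs using Submodule.span_induction with
      | mem y hy =>
        obtain ⟨C, hC, hCQ, hCim, u, hu, rfl⟩ := hy
        have h1 : Zm (C u) = 0 := hZmQ _ (hCim _)
        have h2 : Z0 (C u) = (Z0 * C - C * Z0) u + C (Z0 u) := by
          rw [LinearMap.sub_apply, Module.End.mul_apply, Module.End.mul_apply, sub_add_cancel]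
        have h3 : Zp (C u) = (Zp * C - C * Zp) u := by
          rw [LinearMap.sub_apply, Module.End.mul_apply, Module.End.mul_apply, hZpP _ (hUP hu), map_zero,
            sub_zero]
        have hbr1 : Z0 * C - C * Z0 ∈ 𝔊 := hbr _ hZ0 _ hC
        have hbr1Q : ∀ q ∈ Q, (Z0 * C - C * Z0) q = 0 := fun q hq => by
          rw [LinearMap.sub_apply, Module.End.mul_apply, Module.End.mul_apply, hCQ q hq, map_zero,
            hCQ _ (hZ0Q q hq), sub_zero]
        have hbr1im : ∀ v, (Z0 * C - C * Z0) v ∈ Q := fun v => by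
          rw [LinearMap.sub_apply, Module.End.mul_apply, Module.End.mul_apply]
          exact Submodule.sub_mem _ (hZ0Q _ (hCim v)) (hCim _)
        have hbr2 : Zp * C - C * Zp ∈ 𝔊 := hbr _ hZp _ hC
        have hbr2P : ∀ p ∈ P, (Zp * C - C * Zp) p ∈ P := fun p hp => by
          rw [LinearMap.sub_apply, Module.End.mul_apply, Module.End.mul_apply, hZpP p hp, map_zero, sub_zero]
          exact hZpim _
        rw [hZeq, LinearMap.add_apply, LinearMap.add_apply, h1, zero_add, h2, h3]
        exact Submodule.add_mem _ (Submodule.add_mem _ (hSU' _ hbr1 hbr1Q hbr1im u hu)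
          (hSU' C hC hCQ hCim _ (hU Z0 hZ0 hZ0P u hu))) (hUU' (hU _ hbr2 hbr2P u hu))
      | zero => rw [map_zero]; exact Submodule.zero_mem _
      | add y y' _ _ hy hy' => rw [map_add]; exact Submodule.add_mem _ hy hy'
      | smul c y _ hy => rw [map_smul]; exact Submodule.smul_mem _ _ hy
  rcases hirr U' hU'stab with h | h
  · left
    rw [eq_bot_iff]
    calc U ≤ U' := hUU'
      _ = ⊥ := h
      _ ≤ ⊥ := le_rfl
  · right
    refine le_antisymm hUP fun p hp => ?_
    -- the `P`-components of `U'` lie in `U`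
    set πP : Module.End ℂ M := (2 : ℂ)⁻¹ • (1 + T) with hπP
    have hπPapply : ∀ v, πP v = (2 : ℂ)⁻¹ • (v + T v) := fun v => rfl
    have hπPP : ∀ x ∈ P, πP x = x := fun x hx => by
      rw [hπPapply, hP x hx, ← two_smul ℂ x, smul_smul, inv_mul_cancel₀ (two_ne_zero' ℂ), one_smul]
    have hle : U' ≤ U.comap πP := by
      rw [hU']
      refine sup_le (fun u hu => ?_) ?_
      · rw [Submodule.mem_comap, hπPP u (hUP hu)]
        exact hu
      · rw [Submodule.span_le]
        rintro _ ⟨C, hC, hCQ, hCim, u, hu, rfl⟩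
        rw [SetLike.mem_coe, Submodule.mem_comap, hπPapply, hQ _ (hCim _), add_neg_cancel, smul_zero]
        exact Submodule.zero_mem _
    have hpU' : p ∈ U' := h ▸ Submodule.mem_top
    have h' := hle hpU'
    rwa [Submodule.mem_comap, hπPP p hp] at h'

/-- **The Levi line algebra acts irreducibly on `P`.** In the setting of the orbit lemma, let
`𝔩 ⊆ End(P)` be the space of restrictions to `P` of the elements of `𝔊` preserving `P`. Then `P` has no
`𝔩`-stable subspace other than `0` and `P`. [cite: Gordon1997, §6 (proof of Thm. 6.3.3, p. 19)]
[cite: MoonenZarhin1999LowDim, §2 (2.3)] -/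
theorem SymplecticThetaSix.levi_irreducible (𝔊 : Submodule ℂ (Module.End ℂ M))
    (hbr : ∀ Y ∈ 𝔊, ∀ Z ∈ 𝔊, Y * Z - Z * Y ∈ 𝔊) {T : Module.End ℂ M} (hT𝔊 : T ∈ 𝔊) (hTT : ∀ v, T (T v) = v)
    {P Q : Submodule ℂ M} (hP : ∀ x ∈ P, T x = x) (hQ : ∀ x ∈ Q, T x = -x)
    (hPmem : ∀ v, (2 : ℂ)⁻¹ • (v + T v) ∈ P) (hQmem : ∀ v, (2 : ℂ)⁻¹ • (v - T v) ∈ Q)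
    (hirr : ∀ U : Submodule ℂ M, (∀ Z ∈ 𝔊, ∀ u ∈ U, Z u ∈ U) → U = ⊥ ∨ U = ⊤)
    (U₀ : Submodule ℂ ↥P)
    (hU₀ : ∀ Z ∈ 𝔊, ∀ (hZP : ∀ p ∈ P, Z p ∈ P), ∀ u ∈ U₀, (Z.restrict hZP) u ∈ U₀) :
    U₀ = ⊥ ∨ U₀ = ⊤ := by
  set U : Submodule ℂ M := U₀.map P.subtype with hUdef
  have hUP : U ≤ P := by
    rintro _ ⟨u, -, rfl⟩
    exact u.2
  have hU : ∀ Z ∈ 𝔊, (∀ p ∈ P, Z p ∈ P) → ∀ u ∈ U, Z u ∈ U := by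
    intro Z hZ hZP x hx
    obtain ⟨u, hu, hux⟩ := Submodule.mem_map.1 hx
    refine Submodule.mem_map.2 ⟨Z.restrict hZP u, hU₀ Z hZ hZP u hu, ?_⟩
    rw [← hux]
    rfl
  rcases SymplecticThetaSix.eq_bot_or_eq_of_stable_le 𝔊 hbr hT𝔊 hTT hP hQ hPmem hQmem hirr U hUP hU with h | h
  · left
    rw [eq_bot_iff]
    intro u hu
    rw [Submodule.mem_bot]
    have h1 : (u : M) ∈ U := Submodule.mem_map.2 ⟨u, hu, rfl⟩
    rw [h, Submodule.mem_bot] at h1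
    exact Subtype.ext h1
  · right
    rw [eq_top_iff]
    intro u _
    have h1 : (u : M) ∈ U := by rw [h]; exact u.2
    obtain ⟨u', hu', hu'eq⟩ := Submodule.mem_map.1 h1
    have : u' = u := Subtype.ext hu'eq
    exact this ▸ hu'

end Orbit

/-! ### §2 The rank-one criterion: an irreducible Lie algebra of operators containing `1` and a rank-one
idempotent is everything -/

section RankOne

variable {W : Type*} [AddCommGroup W] [Module ℂ W]

/-- Composition of rank-one operators: `(k ⊗ φ) ∘ (u ⊗ ψ) = φ(u) · (k ⊗ ψ)` (`x ⊗ α` is `v ↦ α(v) x`,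
`LinearMap.smulRight α x`). [folklore] -/
private theorem SymplecticThetaSix.smulRight_mul_smulRight (φ ψ : Module.Dual ℂ W) (k u : W) :
    (φ.smulRight k) * (ψ.smulRight u) = φ u • ψ.smulRight k := by
  refine LinearMap.ext fun w => ?_
  simp only [Module.End.mul_apply, LinearMap.smulRight_apply, LinearMap.smul_apply, map_smul, smul_smul,
    mul_comm]

/-- `x ⊗ α` is additive in `x`. [folklore] -/
private theorem SymplecticThetaSix.smulRight_add_right (φ : Module.Dual ℂ W) (a b : W) :
    φ.smulRight (a + b) = φ.smulRight a + φ.smulRight b := by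
  refine LinearMap.ext fun w => ?_
  simp only [LinearMap.smulRight_apply, LinearMap.add_apply, smul_add]

/-- `x ⊗ α` is homogeneous in `x`. [folklore] -/
private theorem SymplecticThetaSix.smulRight_smul_right (φ : Module.Dual ℂ W) (c : ℂ) (a : W) :
    φ.smulRight (c • a) = c • φ.smulRight a := by
  refine LinearMap.ext fun w => ?_
  simp only [LinearMap.smulRight_apply, LinearMap.smul_apply, smul_comm (φ w) c a]

/-- `x ⊗ α` is subtractive in `x`. [folklore] -/
private theorem SymplecticThetaSix.smulRight_sub_right (φ : Module.Dual ℂ W) (a b : W) :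
    φ.smulRight (a - b) = φ.smulRight a - φ.smulRight b := by
  refine LinearMap.ext fun w => ?_
  simp only [LinearMap.smulRight_apply, LinearMap.sub_apply, smul_sub]

/-- `x ⊗ α` is additive in `α`. [folklore] -/
private theorem SymplecticThetaSix.add_smulRight_left (φ ψ : Module.Dual ℂ W) (a : W) :
    (φ + ψ).smulRight a = φ.smulRight a + ψ.smulRight a := by
  refine LinearMap.ext fun w => ?_
  simp only [LinearMap.smulRight_apply, LinearMap.add_apply, add_smul]

/-- `x ⊗ α` is homogeneous in `α`. [folklore] -/
private theorem SymplecticThetaSix.smul_smulRight_left (φ : Module.Dual ℂ W) (c : ℂ) (a : W) :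
    (c • φ).smulRight a = c • φ.smulRight a := by
  refine LinearMap.ext fun w => ?_
  simp only [LinearMap.smulRight_apply, LinearMap.smul_apply, smul_eq_mul, mul_smul]

/-- `x ⊗ α` is subtractive in `α`. [folklore] -/
private theorem SymplecticThetaSix.sub_smulRight_left (φ ψ : Module.Dual ℂ W) (a : W) :
    (φ - ψ).smulRight a = φ.smulRight a - ψ.smulRight a := by
  refine LinearMap.ext fun w => ?_
  simp only [LinearMap.smulRight_apply, LinearMap.sub_apply, sub_smul]

/-- **The rank-one criterion (Jacobson density for Lie algebras of operators).** Let `𝔩 ⊆ End(W)` (`W`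
finite-dimensional over `ℂ`) be bracket-closed, contain `1` and a rank-one idempotent `e = u ⊗ φ` (`φ(u) = 1`), and
act irreducibly on `W`. Then `𝔩 = End(W)`. Proof: module docstring §2 — grading by the involution `2e − 1` with
eigenspaces `ℂu` and `ker φ` (`SymplecticTheta.exists_decomp`); `K₁ = {k ∈ ker φ : k ⊗ φ ∈ 𝔩} = ker φ` because
`ℂu ⊕ K₁` is `𝔩`-stable and non-zero; the joint kernel in `ker φ` of `{ψ : ψ(u) = 0, u ⊗ ψ ∈ 𝔩}` is `𝔩`-stable
and proper, hence `0`, so these `ψ` exhaust `u^⊥` (duality); finally `k ⊗ ψ = [k ⊗ φ, u ⊗ ψ] + ψ(k) e` and every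
operator is `c e + k ⊗ φ + u ⊗ ψ + Σ kᵢ ⊗ ψᵢ`. (Moonen–Zarhin (2.3): the mechanism behind "`Hg(X) = Sp_{6}`" on the
Levi `𝔤𝔩(V^{1,0})`.) [cite: Humphreys1972, §19.1 and §4.1] [cite: GoodmanWallachGTM255, §4.1.1 and §2.1.2]
[cite: MoonenZarhin1999LowDim, §2 (2.3)] -/
theorem SymplecticThetaSix.eq_top_of_rankOne_idempotent [FiniteDimensional ℂ W]
    (𝔩 : Submodule ℂ (Module.End ℂ W)) (hbr : ∀ A ∈ 𝔩, ∀ A' ∈ 𝔩, A * A' - A' * A ∈ 𝔩) (h1 : (1 : Module.End ℂ W) ∈ 𝔩)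
    (hirr : ∀ U : Submodule ℂ W, (∀ A ∈ 𝔩, ∀ u ∈ U, A u ∈ U) → U = ⊥ ∨ U = ⊤)
    {u : W} {φ : Module.Dual ℂ W} (hφu : φ u = 1) (he : φ.smulRight u ∈ 𝔩) : 𝔩 = ⊤ := by
  classical
  set e : Module.End ℂ W := φ.smulRight u with hedef
  have heapply : ∀ w, e w = φ w • u := fun w => rfl
  have hu0 : u ≠ 0 := fun h => by rw [h, map_zero] at hφu; exact zero_ne_one hφu
  -- the involution `T = 2e - 1` with eigenspaces `L = ℂ u` and `K = ker φ`
  set T : Module.End ℂ W := (2 : ℂ) • e - 1 with hTdef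
  have hTapply : ∀ w, T w = (2 * φ w) • u - w := fun w => by
    rw [hTdef, LinearMap.sub_apply, LinearMap.smul_apply, heapply, smul_smul, Module.End.one_apply]
  have hT𝔩 : T ∈ 𝔩 := Submodule.sub_mem _ (Submodule.smul_mem _ _ he) h1
  have hφT : ∀ w, φ (T w) = φ w := fun w => by
    rw [hTapply, map_sub, map_smul, hφu, smul_eq_mul, mul_one]
    ring
  have hTT : ∀ w, T (T w) = w := fun w => by
    rw [hTapply (T w), hφT, hTapply, sub_sub_cancel]
  set L : Submodule ℂ W := ℂ ∙ u with hLdef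
  set K : Submodule ℂ W := LinearMap.ker φ with hKdef
  have hL : ∀ x ∈ L, T x = x := fun x hx => by
    obtain ⟨c, rfl⟩ := Submodule.mem_span_singleton.1 hx
    rw [hTapply, map_smul, hφu, smul_eq_mul, mul_one]
    module
  have hK : ∀ x ∈ K, T x = -x := fun x hx => by
    rw [hKdef, LinearMap.mem_ker] at hx
    rw [hTapply, hx, mul_zero, zero_smul, zero_sub]
  have hLmem : ∀ w, (2 : ℂ)⁻¹ • (w + T w) ∈ L := fun w => by
    rw [hTapply, hLdef, Submodule.mem_span_singleton]
    exact ⟨φ w, by module⟩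
  have hKmem : ∀ w, (2 : ℂ)⁻¹ • (w - T w) ∈ K := fun w => by
    rw [hKdef, LinearMap.mem_ker, map_smul, map_sub, hφT, sub_self, smul_zero]
  have hdec := fun A (hA : A ∈ 𝔩) => SymplecticTheta.exists_decomp 𝔩 hbr hT𝔩 hTT hL hK hLmem hKmem hA
  -- an operator killing `K` with values in `K` is `k ⊗ φ` with `k` its value at `u`
  have hminus : ∀ A : Module.End ℂ W, (∀ k ∈ K, A k = 0) → A = φ.smulRight (A u) := by
    intro A hAK
    refine LinearMap.ext fun w => ?_
    have hw : w = φ w • u + (w - φ w • u) := by abel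
    have hwK : w - φ w • u ∈ K := by
      rw [hKdef, LinearMap.mem_ker, map_sub, map_smul, hφu, smul_eq_mul, mul_one, sub_self]
    conv_lhs => rw [hw]
    rw [map_add, hAK _ hwK, add_zero, map_smul, LinearMap.smulRight_apply]
  -- an operator killing `L` with values in `L` is `u ⊗ (φ ∘ A)` with `(φ ∘ A)(u) = 0`
  have hplus : ∀ A : Module.End ℂ W, (∀ w, A w ∈ L) → A = (φ ∘ₗ A).smulRight u := by
    intro A hAL
    refine LinearMap.ext fun w => ?_
    obtain ⟨c, hc⟩ := Submodule.mem_span_singleton.1 (hAL w)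
    rw [LinearMap.smulRight_apply, LinearMap.comp_apply, ← hc, map_smul, hφu, smul_eq_mul, mul_one]
  -- Step 1: `k ⊗ φ ∈ 𝔩` for every `k ∈ K`
  set K₁ : Submodule ℂ W :=
    { carrier := {k | k ∈ K ∧ φ.smulRight k ∈ 𝔩}
      zero_mem' := ⟨Submodule.zero_mem _, by rw [LinearMap.smulRight_zero]; exact Submodule.zero_mem _⟩
      add_mem' := fun {a b} ha hb => ⟨Submodule.add_mem _ ha.1 hb.1, by
        rw [SymplecticThetaSix.smulRight_add_right]; exact Submodule.add_mem _ ha.2 hb.2⟩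
      smul_mem' := fun c {a} ha => ⟨Submodule.smul_mem _ _ ha.1, by
        rw [SymplecticThetaSix.smulRight_smul_right]; exact Submodule.smul_mem _ _ ha.2⟩ } with hK₁def
  have hmemK₁ : ∀ k, k ∈ K₁ ↔ k ∈ K ∧ φ.smulRight k ∈ 𝔩 := fun k => Iff.rfl
  -- for `A ∈ 𝔩₀` (preserving `L` and `K`): `φ ∘ A = α φ` where `A u = α u`
  have hzero : ∀ A : Module.End ℂ W, (∀ x ∈ L, A x ∈ L) → (∀ k ∈ K, A k ∈ K) →
      ∃ α : ℂ, A u = α • u ∧ ∀ w, φ (A w) = α * φ w := by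
    intro A hAL hAK
    obtain ⟨α, hα⟩ := Submodule.mem_span_singleton.1 (hAL u (Submodule.mem_span_singleton_self u))
    refine ⟨α, hα.symm, fun w => ?_⟩
    have hw : w = φ w • u + (w - φ w • u) := by abel
    have hwK : w - φ w • u ∈ K := by
      rw [hKdef, LinearMap.mem_ker, map_sub, map_smul, hφu, smul_eq_mul, mul_one, sub_self]
    have h2 : φ (A (w - φ w • u)) = 0 := by
      have h := hAK _ hwK
      rwa [hKdef, LinearMap.mem_ker] at h
    conv_lhs => rw [hw]
    rw [map_add, map_add, h2, add_zero, map_smul, ← hα, map_smul, map_smul, hφu, smul_eq_mul, smul_eq_mul,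
      mul_one, mul_comm]
  have hK₁stab : ∀ A ∈ 𝔩, ∀ x ∈ L ⊔ K₁, A x ∈ L ⊔ K₁ := by
    intro A hA x hx
    obtain ⟨Am, hAm, A0, hA0, Ap, hAp, hAeq, hApL, hApim, hAmK, hAmim, -, -, hA0L, hA0K⟩ := hdec A hA
    rw [Submodule.mem_sup] at hx
    obtain ⟨y, hy, k, hk, rfl⟩ := hx
    obtain ⟨α, hαu, hαφ⟩ := hzero A0 hA0L hA0K
    have hAm_eq : Am = φ.smulRight (Am u) := hminus Am hAmK
    have hAmu : Am u ∈ K₁ := (hmemK₁ _).2 ⟨hAmim u, hAm_eq ▸ hAm⟩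
    rw [map_add]
    refine Submodule.add_mem _ ?_ ?_
    · -- `A y`, `y = c u`: `Am y ∈ K₁`, `A0 y ∈ L`, `Ap y = 0`
      obtain ⟨c, rfl⟩ := Submodule.mem_span_singleton.1 hy
      rw [map_smul]
      refine Submodule.smul_mem _ _ ?_
      rw [hAeq, LinearMap.add_apply, LinearMap.add_apply, hApL u (Submodule.mem_span_singleton_self u), add_zero]
      exact Submodule.add_mem _ (Submodule.mem_sup_right hAmu)
        (Submodule.mem_sup_left (hA0L u (Submodule.mem_span_singleton_self u)))
    · -- `A k`, `k ∈ K₁`: `Am k = 0`, `A0 k ∈ K₁`, `Ap k ∈ L`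
      have hkK : k ∈ K := ((hmemK₁ k).1 hk).1
      rw [hAeq, LinearMap.add_apply, LinearMap.add_apply, hAmK k hkK, zero_add]
      refine Submodule.add_mem _ (Submodule.mem_sup_right ?_) (Submodule.mem_sup_left (hApim k))
      refine (hmemK₁ _).2 ⟨hA0K k hkK, ?_⟩
      -- `[A0, k ⊗ φ] = (A0 k - α k) ⊗ φ`
      have hbr1 : A0 * φ.smulRight k - φ.smulRight k * A0 = φ.smulRight (A0 k - α • k) := by
        refine LinearMap.ext fun w => ?_
        simp only [LinearMap.sub_apply, Module.End.mul_apply, LinearMap.smulRight_apply, map_smul, hαφ w,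
          smul_sub, mul_smul]
        rw [smul_comm (φ w) α k]
      have h2 : φ.smulRight (A0 k - α • k) ∈ 𝔩 := hbr1 ▸ hbr _ hA0 _ ((hmemK₁ k).1 hk).2
      have h3 : φ.smulRight (A0 k) = φ.smulRight (A0 k - α • k) + α • φ.smulRight k := by
        rw [SymplecticThetaSix.smulRight_sub_right, SymplecticThetaSix.smulRight_smul_right, sub_add_cancel]
      rw [h3]
      exact Submodule.add_mem _ h2 (Submodule.smul_mem _ _ ((hmemK₁ k).1 hk).2)
  have hK₁ : ∀ k ∈ K, φ.smulRight k ∈ 𝔩 := by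
    rcases hirr _ hK₁stab with h | h
    · exfalso
      have hu : u ∈ L ⊔ K₁ := Submodule.mem_sup_left (Submodule.mem_span_singleton_self u)
      rw [h, Submodule.mem_bot] at hu
      exact hu0 hu
    · intro k hk
      have hk' : k ∈ L ⊔ K₁ := h ▸ Submodule.mem_top
      rw [Submodule.mem_sup] at hk'
      obtain ⟨y, hy, k₁, hk₁, hyk⟩ := hk'
      obtain ⟨c, rfl⟩ := Submodule.mem_span_singleton.1 hy
      have hc : c = 0 := by
        have h1 : φ k = 0 := by rwa [hKdef, LinearMap.mem_ker] at hk
        have h2 : φ k₁ = 0 := by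
          have := ((hmemK₁ k₁).1 hk₁).1
          rwa [hKdef, LinearMap.mem_ker] at this
        have h3 := congrArg φ hyk
        rw [map_add, map_smul, hφu, h1, h2, smul_eq_mul, mul_one, add_zero] at h3
        exact h3
      rw [hc, zero_smul, zero_add] at hyk
      rw [← hyk]
      exact ((hmemK₁ k₁).1 hk₁).2
  -- Step 2: `u ⊗ ψ ∈ 𝔩` for every `ψ` with `ψ u = 0`
  set Φ₁ : Submodule ℂ (Module.Dual ℂ W) :=
    { carrier := {ψ | ψ u = 0 ∧ ψ.smulRight u ∈ 𝔩}
      zero_mem' := ⟨LinearMap.zero_apply u, by rw [LinearMap.zero_smulRight]; exact Submodule.zero_mem _⟩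
      add_mem' := fun {a b} ha hb => ⟨by rw [LinearMap.add_apply, ha.1, hb.1, add_zero], by
        rw [SymplecticThetaSix.add_smulRight_left]; exact Submodule.add_mem _ ha.2 hb.2⟩
      smul_mem' := fun c {a} ha => ⟨by rw [LinearMap.smul_apply, ha.1, smul_zero], by
        rw [SymplecticThetaSix.smul_smulRight_left]; exact Submodule.smul_mem _ _ ha.2⟩ } with hΦ₁def
  have hmemΦ₁ : ∀ ψ, ψ ∈ Φ₁ ↔ ψ u = 0 ∧ ψ.smulRight u ∈ 𝔩 := fun ψ => Iff.rfl
  -- the joint kernel of `Φ₁` inside `K`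
  set K₀ : Submodule ℂ W := K ⊓ ⨅ ψ : Φ₁, LinearMap.ker (ψ : Module.Dual ℂ W) with hK₀def
  have hmemK₀ : ∀ k, k ∈ K₀ ↔ k ∈ K ∧ ∀ ψ ∈ Φ₁, ψ k = 0 := fun k => by
    simp only [hK₀def, Submodule.mem_inf, Submodule.mem_iInf, LinearMap.mem_ker, Subtype.forall]
  have hK₀stab : ∀ A ∈ 𝔩, ∀ x ∈ K₀, A x ∈ K₀ := by
    intro A hA x hx
    obtain ⟨hxK, hxΦ⟩ := (hmemK₀ x).1 hx
    obtain ⟨Am, hAm, A0, hA0, Ap, hAp, hAeq, hApL, hApim, hAmK, hAmim, -, -, hA0L, hA0K⟩ := hdec A hA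
    obtain ⟨α, hαu, hαφ⟩ := hzero A0 hA0L hA0K
    -- `Ap = u ⊗ ψ₀` with `ψ₀ ∈ Φ₁`, so `Ap x = ψ₀(x) u = 0`
    have hAp_eq : Ap = (φ ∘ₗ Ap).smulRight u := hplus Ap hApim
    have hψ₀ : φ ∘ₗ Ap ∈ Φ₁ := (hmemΦ₁ _).2
      ⟨by rw [LinearMap.comp_apply, hApL u (Submodule.mem_span_singleton_self u), map_zero], hAp_eq ▸ hAp⟩
    have h1 : Ap x = 0 := by
      rw [hAp_eq, LinearMap.smulRight_apply, hxΦ _ hψ₀, zero_smul]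
    rw [hAeq, LinearMap.add_apply, LinearMap.add_apply, hAmK x hxK, zero_add, h1, add_zero]
    refine (hmemK₀ _).2 ⟨hA0K x hxK, fun ψ hψ => ?_⟩
    -- `[A0, u ⊗ ψ] = u ⊗ (α ψ - ψ ∘ A0) ∈ 𝔩`, and it lies in `Φ₁`
    have hbr1 : A0 * ψ.smulRight u - ψ.smulRight u * A0 = (α • ψ - ψ ∘ₗ A0).smulRight u := by
      refine LinearMap.ext fun w => ?_
      simp only [LinearMap.sub_apply, Module.End.mul_apply, LinearMap.smulRight_apply, map_smul, hαu,
        LinearMap.smul_apply, LinearMap.comp_apply, smul_eq_mul, sub_smul, mul_smul]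
      rw [smul_comm]
    have h2 : (α • ψ - ψ ∘ₗ A0) ∈ Φ₁ := (hmemΦ₁ _).2 ⟨by
      rw [LinearMap.sub_apply, LinearMap.smul_apply, LinearMap.comp_apply, hαu, map_smul,
        ((hmemΦ₁ ψ).1 hψ).1, smul_zero, sub_self], hbr1 ▸ hbr _ hA0 _ ((hmemΦ₁ ψ).1 hψ).2⟩
    have h3 := hxΦ _ h2
    rw [LinearMap.sub_apply, LinearMap.smul_apply, LinearMap.comp_apply, hxΦ _ hψ, smul_zero, zero_sub,
      neg_eq_zero] at h3
    exact h3
  have hK₀bot : K₀ = ⊥ := by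
    rcases hirr _ hK₀stab with h | h
    · exact h
    · exfalso
      have hu : u ∈ K₀ := h ▸ Submodule.mem_top
      have hu' := ((hmemK₀ u).1 hu).1
      rw [hKdef, LinearMap.mem_ker, hφu] at hu'
      exact one_ne_zero hu'
  have hΦ₁ : ∀ ψ : Module.Dual ℂ W, ψ u = 0 → ψ.smulRight u ∈ 𝔩 := by
    -- the span of `Φ₁` and `φ` has trivial joint kernel, hence is everything
    set Φ : Submodule ℂ (Module.Dual ℂ W) := Φ₁ ⊔ (ℂ ∙ φ) with hΦdef
    have hcoann : Φ.dualCoannihilator = ⊥ := by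
      rw [eq_bot_iff]
      intro w hw
      rw [Submodule.mem_dualCoannihilator] at hw
      rw [Submodule.mem_bot]
      have hwK : w ∈ K := by
        rw [hKdef, LinearMap.mem_ker]
        exact hw φ (Submodule.mem_sup_right (Submodule.mem_span_singleton_self φ))
      have hwK₀ : w ∈ K₀ := (hmemK₀ w).2 ⟨hwK, fun ψ hψ => hw ψ (Submodule.mem_sup_left hψ)⟩
      rw [hK₀bot, Submodule.mem_bot] at hwK₀
      exact hwK₀
    have hΦtop : Φ = ⊤ := by
      rw [← Subspace.dualCoannihilator_dualAnnihilator_eq (W := Φ), hcoann, Submodule.dualAnnihilator_bot]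
    intro ψ hψu
    have hψ : ψ ∈ Φ := hΦtop ▸ Submodule.mem_top
    rw [hΦdef, Submodule.mem_sup] at hψ
    obtain ⟨ψ₁, hψ₁, χ, hχ, rfl⟩ := hψ
    obtain ⟨c, rfl⟩ := Submodule.mem_span_singleton.1 hχ
    have hc : c = 0 := by
      rw [LinearMap.add_apply, ((hmemΦ₁ ψ₁).1 hψ₁).1, zero_add, LinearMap.smul_apply, hφu, smul_eq_mul,
        mul_one] at hψu
      exact hψu
    rw [hc, zero_smul, add_zero]
    exact ((hmemΦ₁ ψ₁).1 hψ₁).2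
  -- Step 3: `k ⊗ ψ = [k ⊗ φ, u ⊗ ψ] + ψ(k) e ∈ 𝔩` for `k ∈ K`, `ψ u = 0`
  have hKΦ : ∀ k ∈ K, ∀ ψ : Module.Dual ℂ W, ψ u = 0 → ψ.smulRight k ∈ 𝔩 := by
    intro k hk ψ hψu
    have h := hbr _ (hK₁ k hk) _ (hΦ₁ ψ hψu)
    rw [SymplecticThetaSix.smulRight_mul_smulRight, SymplecticThetaSix.smulRight_mul_smulRight, hφu,
      one_smul] at h
    have h2 : ψ.smulRight k = (ψ.smulRight k - ψ k • φ.smulRight u) + ψ k • φ.smulRight u := by abel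
    rw [h2]
    exact Submodule.add_mem _ h (Submodule.smul_mem _ _ he)
  -- conclusion: every operator is `c e + k ⊗ φ + u ⊗ ψ + Y₀₀`
  rw [eq_top_iff]
  intro Y _
  -- decompose `Y` with respect to `T` inside `End(W)` (bracket-closed trivially)
  obtain ⟨Ym, -, Y0, -, Yp, -, hYeq, hYpL, hYpim, hYmK, hYmim, -, -, hY0L, hY0K⟩ :=
    SymplecticTheta.exists_decomp (⊤ : Submodule ℂ (Module.End ℂ W)) (fun _ _ _ _ => Submodule.mem_top)
      (Submodule.mem_top : T ∈ ⊤) hTT hL hK hLmem hKmem (Submodule.mem_top : Y ∈ ⊤)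
  rw [hYeq]
  refine Submodule.add_mem _ (Submodule.add_mem _ ?_ ?_) ?_
  · -- `Ym = (Ym u) ⊗ φ`
    rw [hminus Ym hYmK]
    exact hK₁ _ (hYmim u)
  · -- `Y0 = α e + Y00`, `Y00 = Σ (Y00 kᵢ) ⊗ κᵢ`
    obtain ⟨α, hαu, hαφ⟩ := hzero Y0 hY0L hY0K
    set Y00 := Y0 - α • e with hY00
    have hY00u : Y00 u = 0 := by
      rw [hY00, LinearMap.sub_apply, hαu, LinearMap.smul_apply, heapply, hφu, one_smul, sub_self]
    have hY00K : ∀ w, Y00 w ∈ K := fun w => by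
      rw [hKdef, LinearMap.mem_ker, hY00, LinearMap.sub_apply, map_sub, hαφ, LinearMap.smul_apply, map_smul,
        heapply, map_smul, hφu]
      simp only [smul_eq_mul, mul_one, sub_self]
    have hY0eq : Y0 = Y00 + α • e := by rw [hY00, sub_add_cancel]
    rw [hY0eq]
    refine Submodule.add_mem _ ?_ (Submodule.smul_mem _ _ he)
    -- expand along a basis of `K`
    set bK := Module.finBasis ℂ K with hbK
    -- the projection `w ↦ w - φ(w) u` onto `K`
    set πK : W →ₗ[ℂ] K := LinearMap.codRestrict K (LinearMap.id - φ.smulRight u) (fun w => by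
      rw [hKdef, LinearMap.mem_ker, LinearMap.sub_apply, LinearMap.id_apply, LinearMap.smulRight_apply, map_sub,
        map_smul, hφu, smul_eq_mul, mul_one, sub_self]) with hπK
    have hπKval : ∀ w, ((πK w : K) : W) = w - φ w • u := fun w => rfl
    have hY00π : ∀ w, Y00 w = Y00 (πK w : W) := fun w => by
      rw [hπKval, map_sub, map_smul, hY00u, smul_zero, sub_zero]
    have hexp : Y00 = ∑ i, ((bK.coord i) ∘ₗ πK).smulRight (Y00 (bK i : W)) := by
      refine LinearMap.ext fun w => ?_
      rw [hY00π w, LinearMap.sum_apply]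
      simp only [LinearMap.smulRight_apply, LinearMap.comp_apply]
      have h := bK.sum_repr (πK w)
      conv_lhs => rw [← h]
      rw [Submodule.coe_sum, map_sum]
      refine Finset.sum_congr rfl fun i _ => ?_
      rw [Submodule.coe_smul, map_smul, Module.Basis.coord_apply]
    rw [hexp]
    refine Submodule.sum_mem _ fun i _ => hKΦ _ (hY00K _) _ ?_
    rw [LinearMap.comp_apply, Module.Basis.coord_apply]
    have hπu : πK u = 0 := by
      apply Subtype.ext
      rw [hπKval, hφu, one_smul, sub_self]
      rfl
    rw [hπu, map_zero, Finsupp.zero_apply]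
  · -- `Yp = u ⊗ (φ ∘ Yp)`
    rw [hplus Yp hYpim]
    refine hΦ₁ _ ?_
    rw [LinearMap.comp_apply, hYpL u (Submodule.mem_span_singleton_self u), map_zero]

end RankOne

/-! ### §3 The unipotent radical from the Levi: `𝔊 ⊇ 𝔤𝔩(P)` and `𝔊₊ ≠ 0` give `𝔊₊ = 𝔲⁺` -/

section Plus

variable {M : Type*} [AddCommGroup M] [Module ℂ M]

/-- **A dual system for the Lagrangian pair.** If `P`, `Q` are subspaces with `½(1 ± T)`-decomposition of `M`,
both `ω`-isotropic and in perfect `ω`-duality (`hdetP`, `hdetQ`), then for a basis `b` of `P` there are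
`q_i ∈ Q` with `ω(b_j, q_i) = δ_{ji}`; in particular `dim P = dim Q`. [cite: GoodmanWallachGTM255, §1.1.2 and §2.1.2] -/
theorem SymplecticThetaSix.exists_dual_family [FiniteDimensional ℂ M] (ω : LinearMap.BilinForm ℂ M)
    {P Q : Submodule ℂ M} (hdetP : ∀ x ∈ P, (∀ q ∈ Q, ω x q = 0) → x = 0)
    (hdetQ : ∀ y ∈ Q, (∀ p ∈ P, ω p y = 0) → y = 0) {ι : Type*} [Fintype ι] (b : Module.Basis ι ℂ ↥P) :
    ∃ q : ι → M, (∀ i, q i ∈ Q) ∧ ∀ i j, ω (b j : M) (q i) = b.coord i (b j) := by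
  classical
  set Ψ : ↥Q →ₗ[ℂ] Module.Dual ℂ ↥P := (ω.domRestrict₁₂ P Q).flip with hΨ
  have hΨapply : ∀ (ξ : ↥Q) (p : ↥P), Ψ ξ p = ω (p : M) (ξ : M) := fun ξ p => by
    rw [hΨ, LinearMap.flip_apply, LinearMap.domRestrict₁₂_apply]
  set Ψ' : ↥P →ₗ[ℂ] Module.Dual ℂ ↥Q := ω.domRestrict₁₂ P Q with hΨ'
  have hΨ'apply : ∀ (p : ↥P) (ξ : ↥Q), Ψ' p ξ = ω (p : M) (ξ : M) := fun p ξ => by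
    rw [hΨ', LinearMap.domRestrict₁₂_apply]
  have hΨinj : Function.Injective Ψ := by
    rw [injective_iff_map_eq_zero]
    intro ξ hξ
    exact Subtype.ext (hdetQ _ ξ.2 fun p hp => by
      have h := congrArg (fun f : Module.Dual ℂ ↥P => f ⟨p, hp⟩) hξ
      simpa only [hΨapply, LinearMap.zero_apply] using h)
  have hΨ'inj : Function.Injective Ψ' := by
    rw [injective_iff_map_eq_zero]
    intro p hp
    exact Subtype.ext (hdetP _ p.2 fun q hq => by
      have h := congrArg (fun f : Module.Dual ℂ ↥Q => f ⟨q, hq⟩) hp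
      simpa only [hΨ'apply, LinearMap.zero_apply] using h)
  have h1 := LinearMap.finrank_le_finrank_of_injective hΨinj
  have h2 := LinearMap.finrank_le_finrank_of_injective hΨ'inj
  rw [Subspace.dual_finrank_eq] at h1 h2
  have hdim : Module.finrank ℂ ↥Q = Module.finrank ℂ (Module.Dual ℂ ↥P) := by
    rw [Subspace.dual_finrank_eq]; omega
  have hΨsurj : Function.Surjective Ψ :=
    (LinearMap.injective_iff_surjective_of_finrank_eq_finrank hdim).1 hΨinj
  choose q hq using fun i => hΨsurj (b.coord i)
  refine ⟨fun i => (q i : M), fun i => (q i).2, fun i j => ?_⟩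
  rw [← hΨapply, hq]

/-- **The unipotent radical from the Levi.** Let `ω` be nondegenerate alternating on `M`, `𝔊 ⊆ End(M)`
bracket-closed and `ω`-skew, `T ∈ 𝔊` an involution with eigenspaces `P`, `Q`. Suppose every endomorphism of `P`
is the restriction of an element of `𝔊` preserving `P` and `Q` (THE LEVI `𝔤𝔩(P) ⊆ 𝔊`), and `𝔊₊ ∋ B₀ ≠ 0`. Then
every `ω`-skew `Y` with `Y(P) = 0`, `Y(M) ⊆ P` lies in `𝔊` (`𝔊₊ = 𝔲⁺ ≅ Sym² P`). Proof: (a) a vector `ξ ∈ Q` with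
`ω(B₀ξ, ξ) ≠ 0` and `a ∈ P` with `ω(a, ξ) = 1`; for `Z ∈ 𝔊` restricting to the rank-one idempotent
`p ↦ ω(p, ξ) a` one has `[Z,[Z,B₀]] − [Z,B₀] = 2ω(B₀ξ,ξ) · R_a`, `R_a = ω(a, −) a`, so `R_a ∈ 𝔊`; (b)
`[Z', R_a] = B_{a, Z'a}` and `[Z'', B_{a,c}] = B_{Z''a, c} + B_{a, Z''c}` give all symmetrised products
`B_{d,c} = ω(d,−)c + ω(c,−)d`; (c) `Y = ½ Σ ω(Yq_i, q_j) B_{b_j, b_i}` for a basis `b` of `P` and its `ω`-dual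
family `q` in `Q`. (R11-1 `core_of_irreducible` (A) reached `𝔲⁺` through an invertible element; MZ99 (2.3):
`Hg = Sp₆` contains the Siegel unipotent radical.) [cite: MoonenZarhin1999LowDim, §2 (2.3) and (1.8)]
[cite: GoodmanWallachGTM255, §2.1.2] [cite: Gordon1997, §6 (proof of Thm. 6.3.3, p. 19)] -/
theorem SymplecticThetaSix.plus_mem_of_levi [FiniteDimensional ℂ M] (ω : LinearMap.BilinForm ℂ M)
    (hωnd : ω.Nondegenerate) (hωalt : ∀ x y, ω x y = -ω y x) (𝔊 : Submodule ℂ (Module.End ℂ M))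
    (hbr : ∀ Y ∈ 𝔊, ∀ Z ∈ 𝔊, Y * Z - Z * Y ∈ 𝔊) (hskew : ∀ Z ∈ 𝔊, ∀ x y, ω (Z x) y + ω x (Z y) = 0)
    {T : Module.End ℂ M} (hT𝔊 : T ∈ 𝔊) {P Q : Submodule ℂ M}
    (hP : ∀ x ∈ P, T x = x) (hQ : ∀ x ∈ Q, T x = -x) (hPmem : ∀ v, (2 : ℂ)⁻¹ • (v + T v) ∈ P)
    (hQmem : ∀ v, (2 : ℂ)⁻¹ • (v - T v) ∈ Q)
    (hreal : ∀ A : Module.End ℂ ↥P, ∃ Z ∈ 𝔊, (∀ (p : M) (hp : p ∈ P), Z p = ((A ⟨p, hp⟩ : ↥P) : M)) ∧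
      (∀ p ∈ P, Z p ∈ P) ∧ (∀ q ∈ Q, Z q ∈ Q))
    {B₀ : Module.End ℂ M} (hB₀𝔊 : B₀ ∈ 𝔊) (hB₀P : ∀ p ∈ P, B₀ p = 0) (hB₀im : ∀ v, B₀ v ∈ P) (hB₀0 : B₀ ≠ 0)
    {Y : Module.End ℂ M} (hYskew : ∀ x y, ω (Y x) y + ω x (Y y) = 0) (hYP : ∀ p ∈ P, Y p = 0)
    (hYim : ∀ v, Y v ∈ P) : Y ∈ 𝔊 := by
  classical
  -- basic facts on `T`, `P`, `Q`
  have hPQv : ∀ v, (2 : ℂ)⁻¹ • (v + T v) + (2 : ℂ)⁻¹ • (v - T v) = v := fun v => by module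
  have hTskew := hskew T hT𝔊
  have hPiso : ∀ x ∈ P, ∀ y ∈ P, ω x y = 0 := fun x hx y hy => by
    have h := hTskew x y
    rw [hP x hx, hP y hy] at h
    exact add_self_eq_zero.1 h
  have hQiso : ∀ x ∈ Q, ∀ y ∈ Q, ω x y = 0 := fun x hx y hy => by
    have h := hTskew x y
    rw [hQ x hx, hQ y hy, map_neg, LinearMap.neg_apply, map_neg, ← neg_add, neg_eq_zero, add_self_eq_zero] at h
    exact h
  have hdetP : ∀ x ∈ P, (∀ q ∈ Q, ω x q = 0) → x = 0 := fun x hx h =>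
    hωnd.1 x fun y => by
      rw [← hPQv y, map_add, hPiso x hx _ (hPmem y), h _ (hQmem y), add_zero]
  have hdetQ : ∀ y ∈ Q, (∀ p ∈ P, ω p y = 0) → y = 0 := fun y hy h =>
    hωnd.2 y fun x => by
      rw [← hPQv x, map_add, LinearMap.add_apply, h _ (hPmem x), hQiso _ (hQmem x) y hy, add_zero]
  have hext : ∀ Y Y' : Module.End ℂ M, (∀ p ∈ P, Y p = Y' p) → (∀ q ∈ Q, Y q = Y' q) → Y = Y' :=
    fun Y Y' h1 h2 => LinearMap.ext fun v => by
      rw [← hPQv v, map_add, map_add, h1 _ (hPmem v), h2 _ (hQmem v)]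
  -- a Levi element with prescribed restriction `p ↦ ω(p, ξ) c` (`ξ ∈ Q`, `c ∈ P`), and its action on `Q`
  have hlevi : ∀ ξ ∈ Q, ∀ c ∈ P, ∃ Z ∈ 𝔊, (∀ p ∈ P, Z p = ω p ξ • c) ∧ (∀ p ∈ P, Z p ∈ P) ∧
      (∀ q ∈ Q, Z q ∈ Q) ∧ ∀ η ∈ Q, Z η = -(ω c η • ξ) := by
    intro ξ hξ c hc
    set A : Module.End ℂ ↥P := ((ω.flip ξ) ∘ₗ P.subtype).smulRight ⟨c, hc⟩ with hA
    obtain ⟨Z, hZ, hZA, hZP, hZQ⟩ := hreal A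
    have hZp : ∀ p ∈ P, Z p = ω p ξ • c := fun p hp => by
      rw [hZA p hp]
      rfl
    refine ⟨Z, hZ, hZp, hZP, hZQ, fun η hη => ?_⟩
    rw [← sub_eq_zero, sub_neg_eq_add]
    refine hdetQ _ (Submodule.add_mem _ (hZQ η hη) (Submodule.smul_mem _ _ hξ)) fun p hp => ?_
    have h := hskew Z hZ p η
    rw [hZp p hp, map_smul, LinearMap.smul_apply, smul_eq_mul] at h
    rw [map_add, map_smul, smul_eq_mul]
    linear_combination h
  -- the symmetrised products `B_{d,c}` and the rank-one `R_a`
  have hBsym_apply : ∀ d c x : M, ((ω d).smulRight c + (ω c).smulRight d) x = ω d x • c + ω c x • d :=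
    fun d c x => rfl
  -- (a) a vector `ξ ∈ Q` with `ω(B₀ ξ, ξ) ≠ 0`
  obtain ⟨ξ, hξQ, hξ⟩ : ∃ ξ ∈ Q, ω (B₀ ξ) ξ ≠ 0 := by
    by_contra hcon
    push Not at hcon
    have hsymm : ∀ ξ ∈ Q, ∀ η ∈ Q, ω (B₀ ξ) η = ω (B₀ η) ξ := fun ξ _ η _ => by
      have h := hskew B₀ hB₀𝔊 ξ η
      rw [hωalt ξ (B₀ η)] at h
      linear_combination h
    have hzero : ∀ ξ ∈ Q, ∀ η ∈ Q, ω (B₀ ξ) η = 0 := fun ξ hξ η hη => by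
      have h := hcon (ξ + η) (Submodule.add_mem _ hξ hη)
      simp only [map_add, LinearMap.add_apply, hcon ξ hξ, hcon η hη, zero_add, add_zero] at h
      rw [hsymm η hη ξ hξ, add_self_eq_zero] at h
      exact h
    apply hB₀0
    refine hext B₀ 0 (fun p hp => by rw [hB₀P p hp, LinearMap.zero_apply]) fun q hq => ?_
    rw [LinearMap.zero_apply]
    exact hdetP _ (hB₀im q) fun η hη => hzero q hq η hη
  have hξ0 : ξ ≠ 0 := fun h => by rw [h, map_zero] at hξ; exact hξ rfl
  -- `a ∈ P` with `ω(a, ξ) = 1`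
  obtain ⟨a, haP, haξ⟩ : ∃ a ∈ P, ω a ξ = 1 := by
    by_contra hcon
    push Not at hcon
    apply hξ0
    refine hdetQ ξ hξQ fun p hp => ?_
    by_contra hp0
    exact hcon ((ω p ξ)⁻¹ • p) (Submodule.smul_mem _ _ hp)
      (by rw [map_smul, LinearMap.smul_apply, smul_eq_mul, inv_mul_cancel₀ hp0])
  -- (a') `R_a ∈ 𝔊`
  set R : Module.End ℂ M := (ω a).smulRight a with hRdef
  have hRapply : ∀ x, R x = ω a x • a := fun x => rfl
  have hR𝔊 : R ∈ 𝔊 := by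
    obtain ⟨Z, hZ, hZp, hZP, hZQ, hZη⟩ := hlevi ξ hξQ a haP
    set B₁ := Z * B₀ - B₀ * Z with hB₁
    have hB₁𝔊 : B₁ ∈ 𝔊 := hbr _ hZ _ hB₀𝔊
    have hB₁η : ∀ η ∈ Q, B₁ η = ω (B₀ η) ξ • a + ω a η • B₀ ξ := fun η hη => by
      rw [hB₁, LinearMap.sub_apply, Module.End.mul_apply, Module.End.mul_apply, hZp _ (hB₀im η), hZη η hη,
        map_neg, map_smul, sub_neg_eq_add]
    have hB₁P : ∀ p ∈ P, B₁ p = 0 := fun p hp => by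
      rw [hB₁, LinearMap.sub_apply, Module.End.mul_apply, Module.End.mul_apply, hB₀P p hp, map_zero,
        hB₀P _ (hZP p hp), sub_zero]
    set B₂ := Z * B₁ - B₁ * Z with hB₂
    have hB₂𝔊 : B₂ ∈ 𝔊 := hbr _ hZ _ hB₁𝔊
    have hkey : B₂ - B₁ = (2 * ω (B₀ ξ) ξ) • R := by
      refine hext _ _ (fun p hp => ?_) (fun η hη => ?_)
      · rw [LinearMap.sub_apply, hB₂, LinearMap.sub_apply, Module.End.mul_apply, Module.End.mul_apply,
          hB₁P p hp, map_zero, hB₁P _ (hZP p hp), sub_zero, sub_zero, LinearMap.smul_apply, hRapply,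
          hPiso a haP p hp, zero_smul, smul_zero]
      · have h1 : B₁ ξ = ω (B₀ ξ) ξ • a + ω a ξ • B₀ ξ := hB₁η ξ hξQ
        rw [LinearMap.sub_apply, hB₂, LinearMap.sub_apply, Module.End.mul_apply, Module.End.mul_apply,
          hB₁η η hη, hZη η hη, map_neg, map_smul, h1, map_add, map_smul, map_smul, hZp a haP,
          hZp _ (hB₀im ξ), haξ, LinearMap.smul_apply, hRapply]
        module
    have hmem : (2 * ω (B₀ ξ) ξ) • R ∈ 𝔊 := hkey ▸ Submodule.sub_mem _ hB₂𝔊 hB₁𝔊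
    have hc : (2 * ω (B₀ ξ) ξ) ≠ 0 := mul_ne_zero two_ne_zero hξ
    have h := Submodule.smul_mem _ (2 * ω (B₀ ξ) ξ)⁻¹ hmem
    rwa [smul_smul, inv_mul_cancel₀ hc, one_smul] at h
  -- (b) all symmetrised products `B_{a,c}`, then `B_{d,c}`
  have hBa : ∀ c ∈ P, (ω a).smulRight c + (ω c).smulRight a ∈ 𝔊 := by
    intro c hc
    obtain ⟨Z, hZ, hZp, -, -, -⟩ := hlevi ξ hξQ c hc
    have hZa : Z a = c := by rw [hZp a haP, haξ, one_smul]
    have h : Z * R - R * Z = (ω a).smulRight c + (ω c).smulRight a := by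
      refine LinearMap.ext fun x => ?_
      rw [LinearMap.sub_apply, Module.End.mul_apply, Module.End.mul_apply, hRapply, hRapply, map_smul, hZa,
        hBsym_apply]
      have h1 := hskew Z hZ a x
      rw [hZa] at h1
      have h2 : ω a (Z x) = -ω c x := by linear_combination h1
      rw [h2, neg_smul, sub_neg_eq_add]
    exact h ▸ hbr _ hZ _ hR𝔊
  have hB : ∀ d ∈ P, ∀ c ∈ P, (ω d).smulRight c + (ω c).smulRight d ∈ 𝔊 := by
    intro d hd c hc
    obtain ⟨Z, hZ, hZp, hZP, -, -⟩ := hlevi ξ hξQ d hd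
    have hZa : Z a = d := by rw [hZp a haP, haξ, one_smul]
    have h : Z * ((ω a).smulRight c + (ω c).smulRight a) - ((ω a).smulRight c + (ω c).smulRight a) * Z =
        ((ω d).smulRight c + (ω c).smulRight d) + ((ω a).smulRight (Z c) + (ω (Z c)).smulRight a) := by
      refine LinearMap.ext fun x => ?_
      simp only [LinearMap.sub_apply, Module.End.mul_apply, LinearMap.add_apply, hBsym_apply, map_add, map_smul,
        hZa]
      have h1 := hskew Z hZ a x
      have h2 := hskew Z hZ c x
      rw [hZa] at h1
      have h1' : ω a (Z x) = -ω d x := by linear_combination h1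
      have h2' : ω c (Z x) = -ω (Z c) x := by linear_combination h2
      rw [h1', h2']
      module
    have h2 := hbr _ hZ _ (hBa c hc)
    rw [h] at h2
    have h3 := Submodule.sub_mem _ h2 (hBa _ (hZP c hc))
    rwa [add_sub_cancel_right] at h3
  -- (c) expansion of `Y` along a basis of `P` and its dual family in `Q`
  set b := Module.finBasis ℂ ↥P with hb
  obtain ⟨q, hqQ, hq⟩ := SymplecticThetaSix.exists_dual_family ω hdetP hdetQ b
  have hexpandP : ∀ x ∈ P, x = ∑ i, ω x (q i) • (b i : M) := by
    intro x hx
    have h1 : x = ∑ i, b.repr ⟨x, hx⟩ i • (b i : M) := by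
      have h := congrArg Subtype.val (b.sum_repr ⟨x, hx⟩)
      simp only [Submodule.coe_sum, Submodule.coe_smul] at h
      exact h.symm
    have h2 : ∀ i, ω x (q i) = b.repr ⟨x, hx⟩ i := fun i => by
      conv_lhs => rw [h1]
      simp only [map_sum, map_smul, LinearMap.sum_apply, LinearMap.smul_apply, smul_eq_mul, hq,
        Module.Basis.coord_apply, Module.Basis.repr_self]
      rw [Finset.sum_eq_single i]
      · rw [Finsupp.single_eq_same, mul_one]
      · intro j _ hji
        rw [Finsupp.single_eq_of_ne' hji, mul_zero]
      · intro hi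
        exact absurd (Finset.mem_univ i) hi
    conv_lhs => rw [h1]
    exact Finset.sum_congr rfl fun i _ => by rw [h2 i]
  -- coefficients `y i j = ω (Y q_i) q_j`, symmetric
  have hysymm : ∀ i j, ω (Y (q i)) (q j) = ω (Y (q j)) (q i) := fun i j => by
    have h := hYskew (q i) (q j)
    rw [hωalt (q i) (Y (q j))] at h
    linear_combination h
  have hYη : ∀ η ∈ Q, Y η = ∑ i, ∑ j, (ω (Y (q i)) (q j) * ω (b j : M) η) • (b i : M) := by
    intro η hη
    rw [hexpandP (Y η) (hYim η)]
    refine Finset.sum_congr rfl fun i _ => ?_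
    rw [← Finset.sum_smul]
    congr 1
    have h1 : ω (Y η) (q i) = ω (Y (q i)) η := by
      have h := hYskew η (q i)
      rw [hωalt η (Y (q i))] at h
      linear_combination h
    rw [h1]
    have h2 := congrArg (fun x => ω x η) (hexpandP (Y (q i)) (hYim (q i)))
    simp only [map_sum, map_smul, LinearMap.sum_apply, LinearMap.smul_apply, smul_eq_mul] at h2
    exact h2
  set Y' : Module.End ℂ M :=
    ∑ i, ∑ j, ω (Y (q i)) (q j) • ((ω (b j : M)).smulRight (b i : M) + (ω (b i : M)).smulRight (b j : M))
    with hY'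
  have hY'𝔊 : Y' ∈ 𝔊 :=
    Submodule.sum_mem _ fun i _ => Submodule.sum_mem _ fun j _ =>
      Submodule.smul_mem _ _ (hB _ (b j).2 _ (b i).2)
  have hYY' : (2 : ℂ) • Y = Y' := by
    refine hext _ _ (fun p hp => ?_) (fun η hη => ?_)
    · rw [LinearMap.smul_apply, hYP p hp, smul_zero, hY', LinearMap.sum_apply]
      symm
      refine Finset.sum_eq_zero fun i _ => ?_
      rw [LinearMap.sum_apply]
      refine Finset.sum_eq_zero fun j _ => ?_
      rw [LinearMap.smul_apply, hBsym_apply, hPiso _ (b j).2 p hp, hPiso _ (b i).2 p hp, zero_smul, zero_smul,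
        add_zero, smul_zero]
    · rw [LinearMap.smul_apply, hYη η hη, hY', LinearMap.sum_apply, two_smul]
      simp only [LinearMap.sum_apply, LinearMap.smul_apply, LinearMap.add_apply, LinearMap.smulRight_apply,
        smul_add, smul_smul, Finset.sum_add_distrib]
      congr 1
      rw [Finset.sum_comm]
      refine Finset.sum_congr rfl fun i _ => Finset.sum_congr rfl fun j _ => ?_
      rw [hysymm j i]
  have h := Submodule.smul_mem _ (2 : ℂ)⁻¹ (hYY' ▸ hY'𝔊 : (2 : ℂ) • Y ∈ 𝔊)
  rwa [smul_smul, inv_mul_cancel₀ (two_ne_zero' ℂ), one_smul] at h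

end Plus

/-! ### §4 A rank-one idempotent in the Levi line algebra forces `𝔊 = 𝔲⁻ ⊕ 𝔤𝔩(P) ⊕ 𝔲⁺ = 𝔰𝔭(M, ω)` -/

section Main

variable {M : Type*} [AddCommGroup M] [Module ℂ M]

/-- **The Levi realisation.** If the Levi line algebra `𝔩 = {Z|_P : Z ∈ 𝔊, Z(P) ⊆ P}` is all of `End(P)`, every
endomorphism of `P` is the restriction of an element of `𝔊` preserving `P` AND `Q` (its `𝔊₀`-component,
`SymplecticTheta.exists_decomp`). [cite: GoodmanWallachGTM255, §2.1.2] -/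
theorem SymplecticThetaSix.levi_real (𝔊 : Submodule ℂ (Module.End ℂ M))
    (hbr : ∀ Y ∈ 𝔊, ∀ Z ∈ 𝔊, Y * Z - Z * Y ∈ 𝔊) {T : Module.End ℂ M} (hT𝔊 : T ∈ 𝔊) (hTT : ∀ v, T (T v) = v)
    {P Q : Submodule ℂ M} (hP : ∀ x ∈ P, T x = x) (hQ : ∀ x ∈ Q, T x = -x)
    (hPmem : ∀ v, (2 : ℂ)⁻¹ • (v + T v) ∈ P) (hQmem : ∀ v, (2 : ℂ)⁻¹ • (v - T v) ∈ Q)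
    (htop : ∀ A : Module.End ℂ ↥P, ∃ Z ∈ 𝔊, ∀ p : ↥P, ((A p : ↥P) : M) = Z p) (A : Module.End ℂ ↥P) :
    ∃ Z ∈ 𝔊, (∀ (p : M) (hp : p ∈ P), Z p = ((A ⟨p, hp⟩ : ↥P) : M)) ∧ (∀ p ∈ P, Z p ∈ P) ∧
      (∀ q ∈ Q, Z q ∈ Q) := by
  obtain ⟨Z, hZ, hAZ⟩ := htop A
  obtain ⟨Zm, hZm, Z0, hZ0, Zp, hZp, -, -, -, -, -, hZ0P', -, hZ0P, hZ0Q⟩ :=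
    SymplecticTheta.exists_decomp 𝔊 hbr hT𝔊 hTT hP hQ hPmem hQmem hZ
  refine ⟨Z0, hZ0, fun p hp => ?_, hZ0P, hZ0Q⟩
  have hZp : Z p ∈ P := by rw [← hAZ ⟨p, hp⟩]; exact (A ⟨p, hp⟩).2
  rw [hZ0P' p hp, hP _ hZp, ← two_smul ℂ (Z p), smul_smul, inv_mul_cancel₀ (two_ne_zero' ℂ), one_smul,
    hAZ ⟨p, hp⟩]

/-- **The rank-six core theorem (rank-one form; any rank).** Let `ω` be a nondegenerate alternating form on
a finite-dimensional complex space `M`, `𝔊 ⊆ End(M)` a bracket-closed space of `ω`-skew operators containing an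
involution `T` with eigenspaces `P = ker(T − 1)`, `Q = ker(T + 1)`, such that `M` has no `𝔊`-stable subspace
other than `0`, `M`. Suppose SOME element `Z ∈ 𝔊` preserving `P` restricts to `P` as a rank-one idempotent
`p ↦ ω(p, ξ) a` (`ξ ∈ Q`, `a ∈ P`, `ω(a, ξ) = 1`). Then `𝔊` contains (A) every `ω`-skew `Y` with `Y(P) = 0`,
`Y(M) ⊆ P` (`𝔲⁺`), (B) every `ω`-skew `Y` preserving `P` and `Q` (the Levi `𝔤𝔩(P)`), and (A') every `ω`-skew
`Y` with `Y(Q) = 0`, `Y(M) ⊆ Q` (`𝔲⁻`) — so `𝔊 = 𝔰𝔭(M, ω)`. Proof: `𝔩` is irreducible on `P` (§1) and contains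
`1 = T|_P` and the idempotent, so `𝔩 = End(P)` (§2): the Levi; `𝔊₊ ≠ 0` (else `Q` is stable), so §3 gives
`𝔲⁺`; for `𝔲⁻` apply the same to `(Q, P, −T)`, `−Z` restricting to `Q` as the idempotent `η ↦ ω(η, −a) ξ`.
(Moonen–Zarhin (2.3) Type I(1): "`Hg(X) = Sp(V,φ) ≅ Sp_{6,ℚ}`" — the sequel produces the rank-one idempotent from
`End_Hdg = ℚ`.) [cite: MoonenZarhin1999LowDim, §2 (2.3) and (1.8)] [cite: GoodmanWallachGTM255, §2.1.2]
[cite: Humphreys1972, §19.1] [cite: Gordon1997, §6 (proof of Thm. 6.3.3, p. 19)] -/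
theorem SymplecticThetaSix.core_of_rankOne [FiniteDimensional ℂ M] (ω : LinearMap.BilinForm ℂ M)
    (hωnd : ω.Nondegenerate) (hωalt : ∀ x y, ω x y = -ω y x) (𝔊 : Submodule ℂ (Module.End ℂ M))
    (hbr : ∀ Y ∈ 𝔊, ∀ Z ∈ 𝔊, Y * Z - Z * Y ∈ 𝔊) (hskew : ∀ Z ∈ 𝔊, ∀ x y, ω (Z x) y + ω x (Z y) = 0)
    {T : Module.End ℂ M} (hT𝔊 : T ∈ 𝔊) (hTT : ∀ v, T (T v) = v) {P Q : Submodule ℂ M}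
    (hP : ∀ x ∈ P, T x = x) (hQ : ∀ x ∈ Q, T x = -x) (hPmem : ∀ v, (2 : ℂ)⁻¹ • (v + T v) ∈ P)
    (hQmem : ∀ v, (2 : ℂ)⁻¹ • (v - T v) ∈ Q)
    (hirr : ∀ U : Submodule ℂ M, (∀ Z ∈ 𝔊, ∀ u ∈ U, Z u ∈ U) → U = ⊥ ∨ U = ⊤)
    {Ze : Module.End ℂ M} (hZe : Ze ∈ 𝔊) (hZeP : ∀ p ∈ P, Ze p ∈ P) {a ξ : M} (ha : a ∈ P) (hξ : ξ ∈ Q)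
    (haξ : ω a ξ = 1) (hZea : ∀ p ∈ P, Ze p = ω p ξ • a) :
    (∀ Y : Module.End ℂ M, (∀ x y, ω (Y x) y + ω x (Y y) = 0) → (∀ p ∈ P, Y p = 0) → (∀ v, Y v ∈ P) →
      Y ∈ 𝔊) ∧
    (∀ Y : Module.End ℂ M, (∀ x y, ω (Y x) y + ω x (Y y) = 0) → (∀ p ∈ P, Y p ∈ P) → (∀ q ∈ Q, Y q ∈ Q) →
      Y ∈ 𝔊) ∧
    (∀ Y : Module.End ℂ M, (∀ x y, ω (Y x) y + ω x (Y y) = 0) → (∀ q ∈ Q, Y q = 0) → (∀ v, Y v ∈ Q) →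
      Y ∈ 𝔊) := by
  classical
  -- basic facts on `T`, `P`, `Q`
  have hPQv : ∀ v, (2 : ℂ)⁻¹ • (v + T v) + (2 : ℂ)⁻¹ • (v - T v) = v := fun v => by module
  have hPQ0 : ∀ x ∈ P, x ∈ Q → x = 0 := fun x hxP hxQ => by
    have h1 := hP x hxP
    rw [hQ x hxQ, neg_eq_iff_add_eq_zero, ← two_smul ℂ x, smul_eq_zero] at h1
    exact h1.resolve_left (two_ne_zero' ℂ)
  have hTskew := hskew T hT𝔊
  have hPiso : ∀ x ∈ P, ∀ y ∈ P, ω x y = 0 := fun x hx y hy => by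
    have h := hTskew x y
    rw [hP x hx, hP y hy] at h
    exact add_self_eq_zero.1 h
  have hQiso : ∀ x ∈ Q, ∀ y ∈ Q, ω x y = 0 := fun x hx y hy => by
    have h := hTskew x y
    rw [hQ x hx, hQ y hy, map_neg, LinearMap.neg_apply, map_neg, ← neg_add, neg_eq_zero, add_self_eq_zero] at h
    exact h
  have hdetP : ∀ x ∈ P, (∀ q ∈ Q, ω x q = 0) → x = 0 := fun x hx h =>
    hωnd.1 x fun y => by
      rw [← hPQv y, map_add, hPiso x hx _ (hPmem y), h _ (hQmem y), add_zero]
  have hdetQ : ∀ y ∈ Q, (∀ p ∈ P, ω p y = 0) → y = 0 := fun y hy h =>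
    hωnd.2 y fun x => by
      rw [← hPQv x, map_add, LinearMap.add_apply, h _ (hPmem x), hQiso _ (hQmem x) y hy, add_zero]
  have hext : ∀ Y Y' : Module.End ℂ M, (∀ p ∈ P, Y p = Y' p) → (∀ q ∈ Q, Y q = Y' q) → Y = Y' :=
    fun Y Y' h1 h2 => LinearMap.ext fun v => by
      rw [← hPQv v, map_add, map_add, h1 _ (hPmem v), h2 _ (hQmem v)]
  have hdec := fun Z (hZ : Z ∈ 𝔊) => SymplecticTheta.exists_decomp 𝔊 hbr hT𝔊 hTT hP hQ hPmem hQmem hZ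
  -- data for the mirrored configuration `(Q, P, -T)`
  have hnT𝔊 : -T ∈ 𝔊 := Submodule.neg_mem _ hT𝔊
  have hnTT : ∀ v, (-T) ((-T) v) = v := fun v => by
    rw [LinearMap.neg_apply, LinearMap.neg_apply, map_neg, neg_neg, hTT]
  have hP' : ∀ x ∈ Q, (-T) x = x := fun x hx => by rw [LinearMap.neg_apply, hQ x hx, neg_neg]
  have hQ' : ∀ x ∈ P, (-T) x = -x := fun x hx => by rw [LinearMap.neg_apply, hP x hx]
  have hPmem' : ∀ v, (2 : ℂ)⁻¹ • (v + (-T) v) ∈ Q := fun v => by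
    rw [LinearMap.neg_apply, ← sub_eq_add_neg]; exact hQmem v
  have hQmem' : ∀ v, (2 : ℂ)⁻¹ • (v - (-T) v) ∈ P := fun v => by
    rw [LinearMap.neg_apply, sub_neg_eq_add]; exact hPmem v
  -- `Ze` preserves `Q` and acts there as `η ↦ -ω(a, η) ξ`
  obtain ⟨Zm, hZm, Z0, hZ0, Zp, hZp, hZeq, hZpP, hZpim, hZmQ, hZmim, hZ0P', -, hZ0P, hZ0Q⟩ := hdec Ze hZe
  have hZ0p : ∀ p ∈ P, Z0 p = ω p ξ • a := fun p hp => by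
    rw [hZ0P' p hp, hP _ (hZeP p hp), ← two_smul ℂ (Ze p), smul_smul, inv_mul_cancel₀ (two_ne_zero' ℂ),
      one_smul, hZea p hp]
  have hZ0η : ∀ η ∈ Q, Z0 η = -(ω a η • ξ) := fun η hη => by
    rw [← sub_eq_zero, sub_neg_eq_add]
    refine hdetQ _ (Submodule.add_mem _ (hZ0Q η hη) (Submodule.smul_mem _ _ hξ)) fun p hp => ?_
    have h := hskew Z0 hZ0 p η
    rw [hZ0p p hp, map_smul, LinearMap.smul_apply, smul_eq_mul] at h
    rw [map_add, map_smul, smul_eq_mul]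
    linear_combination h
  -- the Levi line algebra on `P` is everything
  have hleviP : ∀ A : Module.End ℂ ↥P, ∃ Z ∈ 𝔊, ∀ p : ↥P, ((A p : ↥P) : M) = Z p := by
    let 𝔩 : Submodule ℂ (Module.End ℂ ↥P) :=
      { carrier := {A | ∃ Z ∈ 𝔊, ∀ p : ↥P, ((A p : ↥P) : M) = Z p}
        zero_mem' := ⟨0, Submodule.zero_mem _, fun p => by simp⟩
        add_mem' := by
          rintro A A' ⟨Z, hZ, hAZ⟩ ⟨Z', hZ', hAZ'⟩
          exact ⟨Z + Z', Submodule.add_mem _ hZ hZ', fun p => by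
            rw [LinearMap.add_apply, Submodule.coe_add, hAZ, hAZ', LinearMap.add_apply]⟩
        smul_mem' := by
          rintro c A ⟨Z, hZ, hAZ⟩
          exact ⟨c • Z, Submodule.smul_mem _ _ hZ, fun p => by
            rw [LinearMap.smul_apply, Submodule.coe_smul, hAZ, LinearMap.smul_apply]⟩ }
    have hmem𝔩 : ∀ A, A ∈ 𝔩 ↔ ∃ Z ∈ 𝔊, ∀ p : ↥P, ((A p : ↥P) : M) = Z p := fun A => Iff.rfl
    have h𝔩br : ∀ A ∈ 𝔩, ∀ A' ∈ 𝔩, A * A' - A' * A ∈ 𝔩 := by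
      intro A hA A' hA'
      obtain ⟨Z, hZ, hAZ⟩ := (hmem𝔩 A).1 hA
      obtain ⟨Z', hZ', hAZ'⟩ := (hmem𝔩 A').1 hA'
      refine (hmem𝔩 _).2 ⟨Z * Z' - Z' * Z, hbr _ hZ _ hZ', fun p => ?_⟩
      rw [LinearMap.sub_apply, Submodule.coe_sub, Module.End.mul_apply, Module.End.mul_apply, hAZ, hAZ', hAZ',
        hAZ, LinearMap.sub_apply, Module.End.mul_apply, Module.End.mul_apply]
    have h𝔩1 : (1 : Module.End ℂ ↥P) ∈ 𝔩 :=
      (hmem𝔩 _).2 ⟨T, hT𝔊, fun p => by rw [Module.End.one_apply, hP p p.2]⟩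
    have h𝔩irr : ∀ U : Submodule ℂ ↥P, (∀ A ∈ 𝔩, ∀ u ∈ U, A u ∈ U) → U = ⊥ ∨ U = ⊤ := by
      intro U hU
      refine SymplecticThetaSix.levi_irreducible 𝔊 hbr hT𝔊 hTT hP hQ hPmem hQmem hirr U fun Z hZ hZP u hu => ?_
      exact hU _ ((hmem𝔩 _).2 ⟨Z, hZ, fun p => rfl⟩) u hu
    -- the idempotent `p ↦ ω(p, ξ) a` as an element of `𝔩`
    set φ : Module.Dual ℂ ↥P := (ω.flip ξ) ∘ₗ P.subtype with hφ
    have hφapply : ∀ p : ↥P, φ p = ω (p : M) ξ := fun p => rfl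
    have hφa : φ ⟨a, ha⟩ = 1 := by rw [hφapply, haξ]
    have he : φ.smulRight ⟨a, ha⟩ ∈ 𝔩 := (hmem𝔩 _).2 ⟨Z0, hZ0, fun p => by
      rw [LinearMap.smulRight_apply, Submodule.coe_smul, hφapply, hZ0p p p.2]⟩
    have htop := SymplecticThetaSix.eq_top_of_rankOne_idempotent 𝔩 h𝔩br h𝔩1 h𝔩irr hφa he
    intro A
    exact (hmem𝔩 A).1 (htop ▸ Submodule.mem_top)
  have hreal := SymplecticThetaSix.levi_real 𝔊 hbr hT𝔊 hTT hP hQ hPmem hQmem hleviP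
  -- (B) the Levi
  have hB : ∀ Y : Module.End ℂ M, (∀ x y, ω (Y x) y + ω x (Y y) = 0) → (∀ p ∈ P, Y p ∈ P) →
      (∀ q ∈ Q, Y q ∈ Q) → Y ∈ 𝔊 := by
    intro Y hYskew hYP hYQ
    obtain ⟨Z, hZ, hZY, -, hZQ⟩ := hreal (Y.restrict hYP)
    have hZP' : ∀ p ∈ P, Z p = Y p := fun p hp => by rw [hZY p hp]; rfl
    have hZQ' : ∀ q ∈ Q, Z q = Y q := by
      intro q hq
      rw [← sub_eq_zero, ← LinearMap.sub_apply]
      refine hdetQ _ (Submodule.sub_mem _ (hZQ q hq) (hYQ q hq)) fun p hp => ?_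
      have h1 := hskew Z hZ p q
      have h2 := hYskew p q
      rw [LinearMap.sub_apply, map_sub]
      have h3 : ω (Z p) q = ω (Y p) q := by rw [hZP' p hp]
      linear_combination h1 - h2 - h3
    rw [← hext Z Y hZP' hZQ']
    exact hZ
  -- `𝔊₊ ≠ 0` and `𝔊₋ ≠ 0`
  have hPne : P ≠ ⊥ := fun h => by
    have : a = 0 := by rw [← Submodule.mem_bot ℂ, ← h]; exact ha
    rw [this, map_zero, LinearMap.zero_apply] at haξ
    exact zero_ne_one haξ
  have hQne : Q ≠ ⊥ := fun h => by
    have : ξ = 0 := by rw [← Submodule.mem_bot ℂ, ← h]; exact hξ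
    rw [this, map_zero] at haξ
    exact zero_ne_one haξ
  obtain ⟨B₀, hB₀𝔊, hB₀P, hB₀im, hB₀0⟩ : ∃ B ∈ 𝔊, (∀ p ∈ P, B p = 0) ∧ (∀ v, B v ∈ P) ∧ B ≠ 0 := by
    by_contra hcon
    push Not at hcon
    have hQstab : ∀ Z ∈ 𝔊, ∀ q ∈ Q, Z q ∈ Q := by
      intro Z hZ q hq
      obtain ⟨Zm', hZm', Z0', hZ0', Zp', hZp', hZeq', hZpP', hZpim', hZmQ', -, -, -, -, hZ0Q'⟩ := hdec Z hZ
      rw [hZeq', LinearMap.add_apply, LinearMap.add_apply, hZmQ' q hq, zero_add, hcon Zp' hZp' hZpP' hZpim',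
        LinearMap.zero_apply, add_zero]
      exact hZ0Q' q hq
    rcases hirr Q hQstab with h | h
    · exact hQne h
    · exact hPne (by
        rw [eq_bot_iff]
        intro x hx
        rw [Submodule.mem_bot]
        exact hPQ0 x hx (h ▸ Submodule.mem_top))
  obtain ⟨C₀, hC₀𝔊, hC₀Q, hC₀im, hC₀0⟩ : ∃ C ∈ 𝔊, (∀ q ∈ Q, C q = 0) ∧ (∀ v, C v ∈ Q) ∧ C ≠ 0 := by
    by_contra hcon
    push Not at hcon
    have hPstab : ∀ Z ∈ 𝔊, ∀ p ∈ P, Z p ∈ P := by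
      intro Z hZ p hp
      obtain ⟨Zm', hZm', Z0', hZ0', Zp', hZp', hZeq', -, hZpim', hZmQ', hZmim', -, -, hZ0P'', -⟩ := hdec Z hZ
      rw [hZeq', LinearMap.add_apply, LinearMap.add_apply, hcon Zm' hZm' hZmQ' hZmim', LinearMap.zero_apply,
        zero_add]
      exact Submodule.add_mem _ (hZ0P'' p hp) (hZpim' p)
    rcases hirr P hPstab with h | h
    · exact hPne h
    · exact hQne (by
        rw [eq_bot_iff]
        intro x hx
        rw [Submodule.mem_bot]
        exact hPQ0 x (h ▸ Submodule.mem_top) hx)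
  -- (A) the unipotent radical `𝔲⁺`
  have hA : ∀ Y : Module.End ℂ M, (∀ x y, ω (Y x) y + ω x (Y y) = 0) → (∀ p ∈ P, Y p = 0) →
      (∀ v, Y v ∈ P) → Y ∈ 𝔊 := fun Y hYskew hYP hYim =>
    SymplecticThetaSix.plus_mem_of_levi ω hωnd hωalt 𝔊 hbr hskew hT𝔊 hP hQ hPmem hQmem hreal hB₀𝔊 hB₀P hB₀im
      hB₀0 hYskew hYP hYim
  refine ⟨hA, hB, ?_⟩
  -- (A') the opposite radical `𝔲⁻`: the mirrored configuration `(Q, P, -T)` with the idempotent `-Z0|_Q`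
  have hirr' := hirr
  have hnZ0 : -Z0 ∈ 𝔊 := Submodule.neg_mem _ hZ0
  have hnZ0Q : ∀ q ∈ Q, (-Z0) q ∈ Q := fun q hq => by
    rw [LinearMap.neg_apply]; exact Submodule.neg_mem _ (hZ0Q q hq)
  have hna : -a ∈ P := Submodule.neg_mem _ ha
  have hξa : ω ξ (-a) = 1 := by rw [map_neg, hωalt ξ a, neg_neg, haξ]
  have hnZ0η : ∀ η ∈ Q, (-Z0) η = ω η (-a) • ξ := fun η hη => by
    rw [LinearMap.neg_apply, hZ0η η hη, neg_neg, map_neg, hωalt η a, neg_neg]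
  -- the Levi on `Q` via the mirrored rank-one criterion, then §3 mirrored
  have hleviQ : ∀ A : Module.End ℂ ↥Q, ∃ Z ∈ 𝔊, ∀ q : ↥Q, ((A q : ↥Q) : M) = Z q := by
    let 𝔩 : Submodule ℂ (Module.End ℂ ↥Q) :=
      { carrier := {A | ∃ Z ∈ 𝔊, ∀ q : ↥Q, ((A q : ↥Q) : M) = Z q}
        zero_mem' := ⟨0, Submodule.zero_mem _, fun q => by simp⟩
        add_mem' := by
          rintro A A' ⟨Z, hZ, hAZ⟩ ⟨Z', hZ', hAZ'⟩
          exact ⟨Z + Z', Submodule.add_mem _ hZ hZ', fun q => by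
            rw [LinearMap.add_apply, Submodule.coe_add, hAZ, hAZ', LinearMap.add_apply]⟩
        smul_mem' := by
          rintro c A ⟨Z, hZ, hAZ⟩
          exact ⟨c • Z, Submodule.smul_mem _ _ hZ, fun q => by
            rw [LinearMap.smul_apply, Submodule.coe_smul, hAZ, LinearMap.smul_apply]⟩ }
    have hmem𝔩 : ∀ A, A ∈ 𝔩 ↔ ∃ Z ∈ 𝔊, ∀ q : ↥Q, ((A q : ↥Q) : M) = Z q := fun A => Iff.rfl
    have h𝔩br : ∀ A ∈ 𝔩, ∀ A' ∈ 𝔩, A * A' - A' * A ∈ 𝔩 := by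
      intro A hA A' hA'
      obtain ⟨Z, hZ, hAZ⟩ := (hmem𝔩 A).1 hA
      obtain ⟨Z', hZ', hAZ'⟩ := (hmem𝔩 A').1 hA'
      refine (hmem𝔩 _).2 ⟨Z * Z' - Z' * Z, hbr _ hZ _ hZ', fun q => ?_⟩
      rw [LinearMap.sub_apply, Submodule.coe_sub, Module.End.mul_apply, Module.End.mul_apply, hAZ, hAZ', hAZ',
        hAZ, LinearMap.sub_apply, Module.End.mul_apply, Module.End.mul_apply]
    have h𝔩1 : (1 : Module.End ℂ ↥Q) ∈ 𝔩 :=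
      (hmem𝔩 _).2 ⟨-T, hnT𝔊, fun q => by rw [Module.End.one_apply, hP' q q.2]⟩
    have h𝔩irr : ∀ U : Submodule ℂ ↥Q, (∀ A ∈ 𝔩, ∀ u ∈ U, A u ∈ U) → U = ⊥ ∨ U = ⊤ := by
      intro U hU
      refine SymplecticThetaSix.levi_irreducible 𝔊 hbr hnT𝔊 hnTT hP' hQ' hPmem' hQmem' hirr' U
        fun Z hZ hZQ u hu => ?_
      exact hU _ ((hmem𝔩 _).2 ⟨Z, hZ, fun q => rfl⟩) u hu
    set φ : Module.Dual ℂ ↥Q := (ω.flip (-a)) ∘ₗ Q.subtype with hφ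
    have hφapply : ∀ q : ↥Q, φ q = ω (q : M) (-a) := fun q => rfl
    have hφξ : φ ⟨ξ, hξ⟩ = 1 := by rw [hφapply, hξa]
    have he : φ.smulRight ⟨ξ, hξ⟩ ∈ 𝔩 := (hmem𝔩 _).2 ⟨-Z0, hnZ0, fun q => by
      rw [LinearMap.smulRight_apply, Submodule.coe_smul, hφapply, hnZ0η q q.2]⟩
    have htop := SymplecticThetaSix.eq_top_of_rankOne_idempotent 𝔩 h𝔩br h𝔩1 h𝔩irr hφξ he
    intro A
    exact (hmem𝔩 A).1 (htop ▸ Submodule.mem_top)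
  have hreal' := SymplecticThetaSix.levi_real 𝔊 hbr hnT𝔊 hnTT hP' hQ' hPmem' hQmem' hleviQ
  intro Y hYskew hYQ hYim
  exact SymplecticThetaSix.plus_mem_of_levi ω hωnd hωalt 𝔊 hbr hskew hnT𝔊 hP' hQ' hPmem' hQmem' hreal' hC₀𝔊
    hC₀Q hC₀im hC₀0 hYskew hYQ hYim

end Main

/-! ### §5 Products `BC|_P` with two eigenvalues: Cayley–Hamilton idempotents in the Levi line algebra -/

section Spectral

variable {W : Type*} [AddCommGroup W] [Module ℂ W]

/-- An operator with values on a line `ℂu` fixing `u ≠ 0` is the rank-one idempotent `u ⊗ φ`, `φ(u) = 1`.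
[folklore] -/
private theorem SymplecticThetaSix.exists_eq_smulRight (e : Module.End ℂ W) {u : W} (hu : u ≠ 0) (heu : e u = u)
    (hr : ∀ w, e w ∈ ℂ ∙ u) : ∃ φ : Module.Dual ℂ W, φ u = 1 ∧ e = φ.smulRight u := by
  set L := LinearEquiv.toSpanNonzeroSingleton ℂ W u hu with hL
  set φ : Module.Dual ℂ W := L.symm.toLinearMap ∘ₗ LinearMap.codRestrict (ℂ ∙ u) e hr with hφ
  have hφw : ∀ w, φ w • u = e w := fun w => by
    rw [hφ, LinearMap.comp_apply, LinearEquiv.coe_toLinearMap, LinearEquiv.toSpanNonzeroSingleton_symm_apply_smul]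
    rfl
  refine ⟨φ, ?_, LinearMap.ext fun w => ?_⟩
  · have h := hφw u
    rw [heu] at h
    have h2 : (φ u - 1) • u = 0 := by rw [sub_smul, one_smul, h, sub_self]
    exact sub_eq_zero.1 ((smul_eq_zero.1 h2).resolve_right hu)
  · rw [LinearMap.smulRight_apply, hφw]

/-- **Spectral case A.** `X` on `W` with eigenvalues `μ₁ ≠ μ₂`, `(X − μ₁)(X − μ₂) = 0` and `ker(X − μ₁) = ℂv₁`:
then `(μ₁ − μ₂)⁻¹ (X − μ₂)` is the rank-one idempotent onto `ℂv₁` — a polynomial of degree `≤ 2` in `X` of the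
form `u ⊗ φ`. [cite: Humphreys1972, §4.2 (Jordan–Chevalley decomposition)] -/
private theorem SymplecticThetaSix.spectral_caseA (X : Module.End ℂ W) {μ₁ μ₂ : ℂ} (hne : μ₁ ≠ μ₂) {v₁ : W}
    (hv₁ : v₁ ≠ 0) (hXv₁ : X v₁ = μ₁ • v₁)
    (hE : ∀ w, (X - μ₁ • 1) ((X - μ₂ • 1) w) = 0) (hline : ∀ w, (X - μ₁ • 1) w = 0 → w ∈ ℂ ∙ v₁) :
    ∃ (c₀ c₁ c₂ : ℂ) (u : W) (φ : Module.Dual ℂ W), φ u = 1 ∧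
      c₀ • (1 : Module.End ℂ W) + c₁ • X + c₂ • (X * X) = φ.smulRight u := by
  have hd : μ₁ - μ₂ ≠ 0 := sub_ne_zero.2 hne
  set e : Module.End ℂ W := (μ₁ - μ₂)⁻¹ • (X - μ₂ • 1) with he
  have heu : e v₁ = v₁ := by
    rw [he, LinearMap.smul_apply, LinearMap.sub_apply, hXv₁, LinearMap.smul_apply, Module.End.one_apply,
      ← sub_smul, smul_smul, inv_mul_cancel₀ hd, one_smul]
  have hr : ∀ w, e w ∈ ℂ ∙ v₁ := fun w => by
    rw [he, LinearMap.smul_apply]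
    exact Submodule.smul_mem _ _ (hline _ (hE w))
  obtain ⟨φ, hφ, heφ⟩ := SymplecticThetaSix.exists_eq_smulRight e hv₁ heu hr
  refine ⟨-((μ₁ - μ₂)⁻¹ * μ₂), (μ₁ - μ₂)⁻¹, 0, v₁, φ, hφ, ?_⟩
  rw [← heφ, he, smul_sub, smul_smul, zero_smul, add_zero, neg_smul]
  abel

/-- **Spectral case B.** `X` on a three-dimensional `W` with eigenvectors `v₁`, `v₂` for `μ₁ ≠ μ₂`,
`E = (X − μ₁)(X − μ₂) ≠ 0` of rank one with image `ℂu`, and `Xu = μ₁u`: then `u ∈ ℂv₁`, `(X − μ₁)² (X − μ₂) = 0`,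
and `(μ₂ − μ₁)⁻² (X − μ₁)²` is the rank-one idempotent onto `ℂv₂`.
[cite: Humphreys1972, §4.2 (Jordan–Chevalley decomposition)] -/
private theorem SymplecticThetaSix.spectral_caseB [FiniteDimensional ℂ W] (hW : Module.finrank ℂ W = 3)
    (X : Module.End ℂ W) {μ₁ μ₂ : ℂ} (hne : μ₁ ≠ μ₂) {v₁ v₂ : W} (hv₁ : v₁ ≠ 0) (hXv₁ : X v₁ = μ₁ • v₁)
    (hv₂ : v₂ ≠ 0) (hXv₂ : X v₂ = μ₂ • v₂) {u w₀ : W} (hu : u ≠ 0)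
    (hw₀ : (X - μ₁ • 1) ((X - μ₂ • 1) w₀) = u) (hr : ∀ w, (X - μ₁ • 1) ((X - μ₂ • 1) w) ∈ ℂ ∙ u)
    (hXu : X u = μ₁ • u) :
    ∃ (c₀ c₁ c₂ : ℂ) (u : W) (φ : Module.Dual ℂ W), φ u = 1 ∧
      c₀ • (1 : Module.End ℂ W) + c₁ • X + c₂ • (X * X) = φ.smulRight u := by
  set Y₁ : Module.End ℂ W := X - μ₁ • 1 with hY₁
  set Y₂ : Module.End ℂ W := X - μ₂ • 1 with hY₂
  have hY₁apply : ∀ w, Y₁ w = X w - μ₁ • w := fun w => rfl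
  have hY₂apply : ∀ w, Y₂ w = X w - μ₂ • w := fun w => rfl
  have hcomm : ∀ w, Y₁ (Y₂ w) = Y₂ (Y₁ w) := fun w => by
    simp only [hY₁apply, hY₂apply, map_sub, map_smul]
    module
  have hY₁v₁ : Y₁ v₁ = 0 := by rw [hY₁apply, hXv₁, sub_self]
  have hY₂v₂ : Y₂ v₂ = 0 := by rw [hY₂apply, hXv₂, sub_self]
  have hY₂v₁ : Y₂ v₁ = (μ₁ - μ₂) • v₁ := by rw [hY₂apply, hXv₁, sub_smul]
  have hY₁v₂ : Y₁ v₂ = (μ₂ - μ₁) • v₂ := by rw [hY₁apply, hXv₂, sub_smul]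
  have hY₁u : Y₁ u = 0 := by rw [hY₁apply, hXu, sub_self]
  have hd : μ₂ - μ₁ ≠ 0 := sub_ne_zero.2 (Ne.symm hne)
  -- `u ∈ ℂ v₁`: otherwise `E` kills the three independent vectors `v₁, u, v₂`
  have huv₁ : u ∈ ℂ ∙ v₁ := by
    by_contra hcon
    -- `E` kills `ker Y₁ ⊔ ℂ v₂`, which is everything
    set K₁ : Submodule ℂ W := LinearMap.ker Y₁ with hK₁
    have h2 : 2 ≤ Module.finrank ℂ K₁ := by
      have hlt : (ℂ ∙ v₁) < K₁ := by
        refine lt_of_le_of_ne ?_ ?_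
        · rw [Submodule.span_le, Set.singleton_subset_iff, SetLike.mem_coe, hK₁, LinearMap.mem_ker]
          exact hY₁v₁
        · intro h
          exact hcon (h ▸ (show u ∈ K₁ by rw [hK₁, LinearMap.mem_ker]; exact hY₁u))
      have h1 := finrank_span_singleton (K := ℂ) hv₁
      have h3 := Submodule.finrank_lt_finrank_of_lt hlt
      omega
    have hinf : K₁ ⊓ (ℂ ∙ v₂) = ⊥ := by
      rw [eq_bot_iff]
      intro w hw
      rw [Submodule.mem_bot]
      obtain ⟨hw1, hw2⟩ := Submodule.mem_inf.1 hw
      obtain ⟨c, rfl⟩ := Submodule.mem_span_singleton.1 hw2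
      rw [hK₁, LinearMap.mem_ker, map_smul, hY₁v₂, smul_smul, smul_eq_zero] at hw1
      rcases hw1 with h | h
      · rw [(mul_eq_zero.1 h).resolve_right hd, zero_smul]
      · exact absurd h hv₂
    have hsup : K₁ ⊔ (ℂ ∙ v₂) = ⊤ := by
      apply Submodule.eq_top_of_finrank_eq
      have h := Submodule.finrank_sup_add_finrank_inf_eq K₁ (ℂ ∙ v₂)
      rw [hinf, finrank_bot, add_zero, finrank_span_singleton hv₂] at h
      have h' := Submodule.finrank_le (K₁ ⊔ (ℂ ∙ v₂))
      rw [hW] at h' ⊢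
      omega
    have hE0 : ∀ w, Y₁ (Y₂ w) = 0 := by
      intro w
      have hw : w ∈ K₁ ⊔ (ℂ ∙ v₂) := hsup ▸ Submodule.mem_top
      obtain ⟨k, hk, y, hy, rfl⟩ := Submodule.mem_sup.1 hw
      obtain ⟨c, rfl⟩ := Submodule.mem_span_singleton.1 hy
      rw [hK₁, LinearMap.mem_ker] at hk
      rw [map_add, map_add, hcomm k, hk, map_zero, zero_add, map_smul, hY₂v₂, smul_zero, map_zero]
    exact hu (by rw [← hw₀, hE0])
  -- `Y₁ ∘ E = 0`, so `range Y₂ ≤ ker Y₁²`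
  have hY₁E : ∀ w, Y₁ (Y₁ (Y₂ w)) = 0 := fun w => by
    obtain ⟨c, hc⟩ := Submodule.mem_span_singleton.1 (hr w)
    obtain ⟨c', hc'⟩ := Submodule.mem_span_singleton.1 huv₁
    rw [← hc, map_smul, ← hc', map_smul, hY₁v₁, smul_zero, smul_zero]
  -- `rank Y₂ ≥ 2`: `Y₂ v₁` and `Y₂ w₀` are independent
  set R₂ : Submodule ℂ W := LinearMap.range Y₂ with hR₂
  have hR₂two : 2 ≤ Module.finrank ℂ R₂ := by
    have hY₂w₀ : Y₂ w₀ ∉ (ℂ ∙ Y₂ v₁) := by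
      intro h
      obtain ⟨c, hc⟩ := Submodule.mem_span_singleton.1 h
      apply hu
      rw [← hw₀, ← hc, map_smul, hY₂v₁, map_smul, hY₁v₁, smul_zero, smul_zero]
    have hlt : (ℂ ∙ Y₂ v₁) < R₂ := by
      refine lt_of_le_of_ne ?_ ?_
      · rw [Submodule.span_le, Set.singleton_subset_iff]
        exact LinearMap.mem_range_self Y₂ v₁
      · intro h
        exact hY₂w₀ (h ▸ LinearMap.mem_range_self Y₂ w₀)
    have hne0 : Y₂ v₁ ≠ 0 := by
      rw [hY₂v₁]
      exact smul_ne_zero (sub_ne_zero.2 hne) hv₁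
    have h1 := finrank_span_singleton (K := ℂ) hne0
    have h3 := Submodule.finrank_lt_finrank_of_lt hlt
    omega
  -- hence `rank Y₁² ≤ 1` and `range Y₁² = ℂ v₂`
  set S : Module.End ℂ W := Y₁ * Y₁ with hS
  have hSapply : ∀ w, S w = Y₁ (Y₁ w) := fun w => rfl
  have hker : R₂ ≤ LinearMap.ker S := by
    rintro _ ⟨w, rfl⟩
    rw [LinearMap.mem_ker, hSapply, hY₁E]
  have hSv₂ : S v₂ = ((μ₂ - μ₁) * (μ₂ - μ₁)) • v₂ := by
    rw [hSapply, hY₁v₂, map_smul, hY₁v₂, smul_smul]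
  have hSv₂0 : S v₂ ≠ 0 := by rw [hSv₂]; exact smul_ne_zero (mul_ne_zero hd hd) hv₂
  have hrange : LinearMap.range S = ℂ ∙ v₂ := by
    have h1 := LinearMap.finrank_range_add_finrank_ker S
    have h2 := Submodule.finrank_mono hker
    have h3 : Module.finrank ℂ (LinearMap.range S) ≤ 1 := by rw [hW] at h1; omega
    have hle : (ℂ ∙ S v₂) ≤ LinearMap.range S := by
      rw [Submodule.span_le, Set.singleton_subset_iff]
      exact LinearMap.mem_range_self S v₂
    have heq := Submodule.eq_of_le_of_finrank_le hle (by rw [finrank_span_singleton hSv₂0]; exact h3)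
    rw [← heq, hSv₂]
    exact Submodule.span_singleton_smul_eq (IsUnit.mk0 _ (mul_ne_zero hd hd)) v₂
  -- the idempotent `((μ₂ - μ₁)²)⁻¹ Y₁²`
  set e : Module.End ℂ W := ((μ₂ - μ₁) * (μ₂ - μ₁))⁻¹ • S with he
  have heu : e v₂ = v₂ := by
    rw [he, LinearMap.smul_apply, hSv₂, smul_smul, inv_mul_cancel₀ (mul_ne_zero hd hd), one_smul]
  have hr' : ∀ w, e w ∈ ℂ ∙ v₂ := fun w => by
    rw [he, LinearMap.smul_apply, ← hrange]
    exact Submodule.smul_mem _ _ (LinearMap.mem_range_self S w)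
  obtain ⟨φ, hφ, heφ⟩ := SymplecticThetaSix.exists_eq_smulRight e hv₂ heu hr'
  set c : ℂ := ((μ₂ - μ₁) * (μ₂ - μ₁))⁻¹ with hc
  refine ⟨c * (μ₁ * μ₁), -(c * (2 * μ₁)), c, v₂, φ, hφ, ?_⟩
  rw [← heφ, he, hS]
  refine LinearMap.ext fun w => ?_
  simp only [LinearMap.add_apply, LinearMap.smul_apply, Module.End.one_apply, Module.End.mul_apply, hY₁apply,
    map_sub, map_smul]
  module

/-- **The spectral lemma (dimension three).** Let `X` be an operator on a three-dimensional complex space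
with two distinct eigenvalues. Then some polynomial of degree `≤ 2` in `X` is a rank-one idempotent
`u ⊗ φ` (`φ(u) = 1`): the spectral projection onto a simple eigenvalue (Cayley–Hamilton / Jordan form).
[cite: Humphreys1972, §4.2 (Jordan–Chevalley decomposition)] -/
theorem SymplecticThetaSix.exists_rankOne_polynomial [FiniteDimensional ℂ W] (hW : Module.finrank ℂ W = 3)
    (X : Module.End ℂ W) {μ₁ μ₂ : ℂ} (hne : μ₁ ≠ μ₂) {v₁ v₂ : W} (hv₁ : v₁ ≠ 0) (hXv₁ : X v₁ = μ₁ • v₁)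
    (hv₂ : v₂ ≠ 0) (hXv₂ : X v₂ = μ₂ • v₂) :
    ∃ (c₀ c₁ c₂ : ℂ) (u : W) (φ : Module.Dual ℂ W), φ u = 1 ∧
      c₀ • (1 : Module.End ℂ W) + c₁ • X + c₂ • (X * X) = φ.smulRight u := by
  set Y₁ : Module.End ℂ W := X - μ₁ • 1 with hY₁
  set Y₂ : Module.End ℂ W := X - μ₂ • 1 with hY₂
  have hY₁apply : ∀ w, Y₁ w = X w - μ₁ • w := fun w => rfl
  have hY₂apply : ∀ w, Y₂ w = X w - μ₂ • w := fun w => rfl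
  have hcomm : ∀ w, Y₁ (Y₂ w) = Y₂ (Y₁ w) := fun w => by
    simp only [hY₁apply, hY₂apply, map_sub, map_smul]
    module
  have hY₁v₁ : Y₁ v₁ = 0 := by rw [hY₁apply, hXv₁, sub_self]
  have hY₂v₂ : Y₂ v₂ = 0 := by rw [hY₂apply, hXv₂, sub_self]
  have hY₂v₁ : Y₂ v₁ = (μ₁ - μ₂) • v₁ := by rw [hY₂apply, hXv₁, sub_smul]
  have hY₁v₂ : Y₁ v₂ = (μ₂ - μ₁) • v₂ := by rw [hY₁apply, hXv₂, sub_smul]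
  have hd : μ₁ - μ₂ ≠ 0 := sub_ne_zero.2 hne
  have hd' : μ₂ - μ₁ ≠ 0 := sub_ne_zero.2 (Ne.symm hne)
  by_cases hE : ∀ w, Y₁ (Y₂ w) = 0
  · -- case A: `X` is diagonalisable with eigenvalues `μ₁`, `μ₂`; one eigenspace is a line
    by_cases hline : ∀ w, Y₁ w = 0 → w ∈ ℂ ∙ v₁
    · exact SymplecticThetaSix.spectral_caseA X hne hv₁ hXv₁ hE hline
    · push Not at hline
      obtain ⟨w₁, hw₁, hw₁v⟩ := hline
      have hline' : ∀ w, Y₂ w = 0 → w ∈ ℂ ∙ v₂ := by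
        -- `dim ker Y₁ ≥ 2`, `ker Y₁ ∩ ker Y₂ = 0`, so `dim ker Y₂ ≤ 1`
        set K₁ : Submodule ℂ W := LinearMap.ker Y₁ with hK₁
        set K₂ : Submodule ℂ W := LinearMap.ker Y₂ with hK₂
        have h2 : 2 ≤ Module.finrank ℂ K₁ := by
          have hlt : (ℂ ∙ v₁) < K₁ := by
            refine lt_of_le_of_ne ?_ ?_
            · rw [Submodule.span_le, Set.singleton_subset_iff, SetLike.mem_coe, hK₁, LinearMap.mem_ker]
              exact hY₁v₁
            · intro h
              exact hw₁v (h ▸ (show w₁ ∈ K₁ by rw [hK₁, LinearMap.mem_ker]; exact hw₁))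
          have h1 := finrank_span_singleton (K := ℂ) hv₁
          have h3 := Submodule.finrank_lt_finrank_of_lt hlt
          omega
        have hinf : K₁ ⊓ K₂ = ⊥ := by
          rw [eq_bot_iff]
          intro w hw
          rw [Submodule.mem_bot]
          obtain ⟨hw1, hw2⟩ := Submodule.mem_inf.1 hw
          rw [hK₁, LinearMap.mem_ker, hY₁apply] at hw1
          rw [hK₂, LinearMap.mem_ker, hY₂apply] at hw2
          have h : (μ₁ - μ₂) • w = 0 := by
            rw [sub_smul]
            have h1 : X w = μ₁ • w := sub_eq_zero.1 hw1
            have h2 : X w = μ₂ • w := sub_eq_zero.1 hw2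
            rw [← h1, ← h2, sub_self]
          exact (smul_eq_zero.1 h).resolve_left hd
        have hK₂le : Module.finrank ℂ K₂ ≤ 1 := by
          have h := Submodule.finrank_sup_add_finrank_inf_eq K₁ K₂
          rw [hinf, finrank_bot, add_zero] at h
          have h' := Submodule.finrank_le (K₁ ⊔ K₂)
          rw [hW] at h'
          omega
        intro w hw
        have hv₂K : v₂ ∈ K₂ := by rw [hK₂, LinearMap.mem_ker]; exact hY₂v₂
        have hle : (ℂ ∙ v₂) ≤ K₂ := by
          rw [Submodule.span_le, Set.singleton_subset_iff]
          exact hv₂K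
        have heq := Submodule.eq_of_le_of_finrank_le hle (by rw [finrank_span_singleton hv₂]; exact hK₂le)
        rw [heq, hK₂, LinearMap.mem_ker]
        exact hw
      have hE' : ∀ w, Y₂ (Y₁ w) = 0 := fun w => by rw [← hcomm]; exact hE w
      exact SymplecticThetaSix.spectral_caseA X (Ne.symm hne) hv₂ hXv₂ hE' hline'
  · -- case B: `E = Y₁ Y₂ ≠ 0` has rank one with image an eigenline `ℂ u`
    push Not at hE
    obtain ⟨w₀, hw₀⟩ := hE
    set u := Y₁ (Y₂ w₀) with hu
    -- `rank E ≤ 1` since `E` kills `v₁` and `v₂`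
    set E : Module.End ℂ W := Y₁ * Y₂ with hEdef
    have hEapply : ∀ w, E w = Y₁ (Y₂ w) := fun w => rfl
    have hEv₁ : E v₁ = 0 := by rw [hEapply, hY₂v₁, map_smul, hY₁v₁, smul_zero]
    have hEv₂ : E v₂ = 0 := by rw [hEapply, hY₂v₂, map_zero]
    have hr : ∀ w, Y₁ (Y₂ w) ∈ ℂ ∙ u := by
      have h2 : 2 ≤ Module.finrank ℂ (LinearMap.ker E) := by
        have hv₂v₁ : v₂ ∉ (ℂ ∙ v₁) := by
          intro h
          obtain ⟨c, hc⟩ := Submodule.mem_span_singleton.1 h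
          have h1 := hXv₂
          rw [← hc, map_smul, hXv₁, smul_smul, smul_smul, mul_comm] at h1
          have h2 : (c * μ₁ - c * μ₂) • v₁ = 0 := by rw [sub_smul, mul_comm c μ₁, h1, mul_comm, sub_self]
          rcases mul_eq_zero.1 (show c * (μ₁ - μ₂) = 0 from by
            have := (smul_eq_zero.1 h2).resolve_right hv₁; rwa [← mul_sub] at this) with h | h
          · rw [h, zero_smul] at hc; exact hv₂ hc.symm
          · exact hd h
        have hlt : (ℂ ∙ v₁) < LinearMap.ker E := by
          refine lt_of_le_of_ne ?_ ?_
          · rw [Submodule.span_le, Set.singleton_subset_iff, SetLike.mem_coe, LinearMap.mem_ker]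
            exact hEv₁
          · intro h
            exact hv₂v₁ (h ▸ (show v₂ ∈ LinearMap.ker E by rw [LinearMap.mem_ker]; exact hEv₂))
        have h1 := finrank_span_singleton (K := ℂ) hv₁
        have h3 := Submodule.finrank_lt_finrank_of_lt hlt
        omega
      have h1 := LinearMap.finrank_range_add_finrank_ker E
      have h3 : Module.finrank ℂ (LinearMap.range E) ≤ 1 := by rw [hW] at h1; omega
      have hle : (ℂ ∙ u) ≤ LinearMap.range E := by
        rw [Submodule.span_le, Set.singleton_subset_iff]
        exact LinearMap.mem_range_self E w₀
      have heq := Submodule.eq_of_le_of_finrank_le hle (by rw [finrank_span_singleton hw₀]; exact h3)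
      intro w
      rw [heq]
      exact LinearMap.mem_range_self E w
    -- `u` is an eigenvector: `X u = ν u`
    have hXu : X u ∈ ℂ ∙ u := by
      have h : X u = Y₁ (Y₂ (X w₀)) := by
        simp only [hu, hY₁apply, hY₂apply, map_sub, map_smul]
      rw [h]
      exact hr (X w₀)
    obtain ⟨ν, hν⟩ := Submodule.mem_span_singleton.1 hXu
    by_cases hν₁ : ν = μ₁
    · rw [hν₁] at hν
      exact SymplecticThetaSix.spectral_caseB hW X hne hv₁ hXv₁ hv₂ hXv₂ hw₀ rfl hr hν.symm
    by_cases hν₂ : ν = μ₂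
    · rw [hν₂] at hν
      have hr' : ∀ w, Y₂ (Y₁ w) ∈ ℂ ∙ u := fun w => by rw [← hcomm]; exact hr w
      have hw₀' : Y₂ (Y₁ w₀) = u := by rw [← hcomm]
      exact SymplecticThetaSix.spectral_caseB hW X (Ne.symm hne) hv₂ hXv₂ hv₁ hXv₁ hw₀ hw₀' hr' hν.symm
    · -- `ν ∉ {μ₁, μ₂}`: `E u = (ν - μ₁)(ν - μ₂) u`, and `E/((ν - μ₁)(ν - μ₂))` is the idempotent onto `ℂ u`
      have hκ : (ν - μ₁) * (ν - μ₂) ≠ 0 := mul_ne_zero (sub_ne_zero.2 hν₁) (sub_ne_zero.2 hν₂)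
      have hEu : E u = ((ν - μ₁) * (ν - μ₂)) • u := by
        rw [hEapply, hY₂apply, ← hν, ← sub_smul, map_smul, hY₁apply, ← hν, ← sub_smul, smul_smul, mul_comm]
      set e : Module.End ℂ W := ((ν - μ₁) * (ν - μ₂))⁻¹ • E with he
      have heu : e u = u := by
        rw [he, LinearMap.smul_apply, hEu, smul_smul, inv_mul_cancel₀ hκ, one_smul]
      have hr' : ∀ w, e w ∈ ℂ ∙ u := fun w => by
        rw [he, LinearMap.smul_apply]
        exact Submodule.smul_mem _ _ (hr w)
      obtain ⟨φ, hφ, heφ⟩ := SymplecticThetaSix.exists_eq_smulRight e hw₀ heu hr'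
      set c : ℂ := ((ν - μ₁) * (ν - μ₂))⁻¹ with hc
      refine ⟨c * (μ₁ * μ₂), -(c * (μ₁ + μ₂)), c, u, φ, hφ, ?_⟩
      rw [← heφ, he, hEdef]
      refine LinearMap.ext fun w => ?_
      simp only [LinearMap.add_apply, LinearMap.smul_apply, Module.End.one_apply, Module.End.mul_apply, hY₁apply,
        hY₂apply, map_sub, map_smul]
      module

end Spectral

section TwoEigenvalues

variable {M : Type*} [AddCommGroup M] [Module ℂ M]

/-- **Dual representation.** In the Lagrangian pair, every functional on `P` is `p ↦ ω(p, ξ)` for some `ξ ∈ Q`.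
[cite: GoodmanWallachGTM255, §1.1.2 and §2.1.2] -/
theorem SymplecticThetaSix.exists_repr_dual [FiniteDimensional ℂ M] (ω : LinearMap.BilinForm ℂ M)
    {P Q : Submodule ℂ M} (hdetP : ∀ x ∈ P, (∀ q ∈ Q, ω x q = 0) → x = 0)
    (hdetQ : ∀ y ∈ Q, (∀ p ∈ P, ω p y = 0) → y = 0) (φ : Module.Dual ℂ ↥P) :
    ∃ ξ ∈ Q, ∀ p : ↥P, ω (p : M) ξ = φ p := by
  classical
  set b := Module.finBasis ℂ ↥P with hb
  obtain ⟨q, hqQ, hq⟩ := SymplecticThetaSix.exists_dual_family ω hdetP hdetQ b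
  refine ⟨∑ i, φ (b i) • q i, Submodule.sum_mem _ fun i _ => Submodule.smul_mem _ _ (hqQ i), fun p => ?_⟩
  have hp : p = ∑ j, b.repr p j • b j := (b.sum_repr p).symm
  conv_lhs => rw [hp]
  conv_rhs => rw [hp]
  simp only [map_sum, map_smul, Submodule.coe_sum, Submodule.coe_smul, LinearMap.sum_apply,
    LinearMap.smul_apply, smul_eq_mul, hq, Module.Basis.coord_apply, Module.Basis.repr_self]
  refine Finset.sum_congr rfl fun j _ => ?_
  rw [Finset.sum_eq_single j]
  · rw [Finsupp.single_eq_same, mul_one, mul_comm]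
  · intro i _ hij
    rw [Finsupp.single_eq_of_ne' hij, mul_zero]
  · intro hj
    exact absurd (Finset.mem_univ j) hj

/-- **The rank-six core theorem (two-eigenvalue form).** In the setting of `core_of_rankOne` with `dim P = 3`,
suppose some `B ∈ 𝔊₊` (`B(P) = 0`, `B(M) ⊆ P`) and some `C ∈ 𝔊` (e.g. `C ∈ 𝔊₋`) have a product `BC|_P`
with TWO DISTINCT EIGENVALUES. Then `𝔊 ⊇ 𝔲⁺ ⊕ 𝔤𝔩(P) ⊕ 𝔲⁻`, i.e. `𝔊 = 𝔰𝔭(M, ω)`. Proof: `[B,C]` and `[BCB, C]`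
(`BCB = ½[[B,C],B] ∈ 𝔊₊`) lie in `𝔊₀` and restrict to `P` as `X = BC|_P` and `X²`; with `1 = T|_P`, the
spectral lemma (§5) provides a rank-one idempotent `c₀ + c₁X + c₂X²` realised in `𝔊₀`, and `core_of_rankOne`
(§4) concludes. In the E³-type alternative (`𝔰𝔩₂ ⊗ 1 ⊕ 1 ⊗ 𝔰𝔬₃`) every product `BC|_P` is a scalar — the
sequel shows that under `End_Hdg(V) = ℚ` this alternative is impossible (MZ99 (2.3): `Hg = Sp₆`).
[cite: MoonenZarhin1999LowDim, §2 (2.3) and (1.8)] [cite: GoodmanWallachGTM255, §2.1.2]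
[cite: Humphreys1972, §4.2 and §19.1] [cite: Gordon1997, §6 (proof of Thm. 6.3.3, p. 19)] -/
theorem SymplecticThetaSix.core_of_twoEigenvalues [FiniteDimensional ℂ M] (ω : LinearMap.BilinForm ℂ M)
    (hωnd : ω.Nondegenerate) (hωalt : ∀ x y, ω x y = -ω y x) (𝔊 : Submodule ℂ (Module.End ℂ M))
    (hbr : ∀ Y ∈ 𝔊, ∀ Z ∈ 𝔊, Y * Z - Z * Y ∈ 𝔊) (hskew : ∀ Z ∈ 𝔊, ∀ x y, ω (Z x) y + ω x (Z y) = 0)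
    {T : Module.End ℂ M} (hT𝔊 : T ∈ 𝔊) (hTT : ∀ v, T (T v) = v) {P Q : Submodule ℂ M}
    (hP : ∀ x ∈ P, T x = x) (hQ : ∀ x ∈ Q, T x = -x) (hPmem : ∀ v, (2 : ℂ)⁻¹ • (v + T v) ∈ P)
    (hQmem : ∀ v, (2 : ℂ)⁻¹ • (v - T v) ∈ Q)
    (hirr : ∀ U : Submodule ℂ M, (∀ Z ∈ 𝔊, ∀ u ∈ U, Z u ∈ U) → U = ⊥ ∨ U = ⊤)
    (hP3 : Module.finrank ℂ ↥P = 3) {B C : Module.End ℂ M} (hB𝔊 : B ∈ 𝔊) (hBP : ∀ p ∈ P, B p = 0)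
    (hBim : ∀ v, B v ∈ P) (hC𝔊 : C ∈ 𝔊) {μ₁ μ₂ : ℂ}
    (hne : μ₁ ≠ μ₂) {v₁ v₂ : M} (hv₁P : v₁ ∈ P) (hv₁ : v₁ ≠ 0) (hXv₁ : B (C v₁) = μ₁ • v₁) (hv₂P : v₂ ∈ P)
    (hv₂ : v₂ ≠ 0) (hXv₂ : B (C v₂) = μ₂ • v₂) :
    (∀ Y : Module.End ℂ M, (∀ x y, ω (Y x) y + ω x (Y y) = 0) → (∀ p ∈ P, Y p = 0) → (∀ v, Y v ∈ P) →
      Y ∈ 𝔊) ∧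
    (∀ Y : Module.End ℂ M, (∀ x y, ω (Y x) y + ω x (Y y) = 0) → (∀ p ∈ P, Y p ∈ P) → (∀ q ∈ Q, Y q ∈ Q) →
      Y ∈ 𝔊) ∧
    (∀ Y : Module.End ℂ M, (∀ x y, ω (Y x) y + ω x (Y y) = 0) → (∀ q ∈ Q, Y q = 0) → (∀ v, Y v ∈ Q) →
      Y ∈ 𝔊) := by
  classical
  -- basic facts on `T`, `P`, `Q`
  have hPQv : ∀ v, (2 : ℂ)⁻¹ • (v + T v) + (2 : ℂ)⁻¹ • (v - T v) = v := fun v => by module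
  have hTskew := hskew T hT𝔊
  have hPiso : ∀ x ∈ P, ∀ y ∈ P, ω x y = 0 := fun x hx y hy => by
    have h := hTskew x y
    rw [hP x hx, hP y hy] at h
    exact add_self_eq_zero.1 h
  have hQiso : ∀ x ∈ Q, ∀ y ∈ Q, ω x y = 0 := fun x hx y hy => by
    have h := hTskew x y
    rw [hQ x hx, hQ y hy, map_neg, LinearMap.neg_apply, map_neg, ← neg_add, neg_eq_zero, add_self_eq_zero] at h
    exact h
  have hdetP : ∀ x ∈ P, (∀ q ∈ Q, ω x q = 0) → x = 0 := fun x hx h =>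
    hωnd.1 x fun y => by
      rw [← hPQv y, map_add, hPiso x hx _ (hPmem y), h _ (hQmem y), add_zero]
  have hdetQ : ∀ y ∈ Q, (∀ p ∈ P, ω p y = 0) → y = 0 := fun y hy h =>
    hωnd.2 y fun x => by
      rw [← hPQv x, map_add, LinearMap.add_apply, h _ (hPmem x), hQiso _ (hQmem x) y hy, add_zero]
  -- `B² = 0`, `BCB ∈ 𝔊`
  have hBB : B * B = 0 := LinearMap.ext fun v => by
    rw [Module.End.mul_apply, hBP _ (hBim v), LinearMap.zero_apply]
  have hZ₁ : B * C - C * B ∈ 𝔊 := hbr _ hB𝔊 _ hC𝔊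
  have hBCB : B * C * B ∈ 𝔊 := by
    have h : (B * C - C * B) * B - B * (B * C - C * B) = (2 : ℂ) • (B * C * B) := by
      rw [sub_mul, mul_sub, mul_assoc C B B, hBB, mul_zero, sub_zero, ← mul_assoc B B C, hBB, zero_mul,
        zero_sub, sub_neg_eq_add, ← mul_assoc, two_smul]
    have h2 := hbr _ hZ₁ _ hB𝔊
    rw [h] at h2
    have h3 := Submodule.smul_mem _ (2 : ℂ)⁻¹ h2
    rwa [smul_smul, inv_mul_cancel₀ (two_ne_zero' ℂ), one_smul] at h3
  have hZ₂ : B * C * B * C - C * (B * C * B) ∈ 𝔊 := hbr _ hBCB _ hC𝔊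
  -- the operator `X = BC|_P` on `P`
  have hBCP : ∀ p ∈ P, (B * C) p ∈ P := fun p _ => hBim _
  set X : Module.End ℂ ↥P := (B * C).restrict hBCP with hXdef
  have hXapply : ∀ p : ↥P, ((X p : ↥P) : M) = B (C p) := fun p => rfl
  have hXv₁' : X ⟨v₁, hv₁P⟩ = μ₁ • ⟨v₁, hv₁P⟩ := Subtype.ext (by rw [hXapply, Submodule.coe_smul, hXv₁])
  have hXv₂' : X ⟨v₂, hv₂P⟩ = μ₂ • ⟨v₂, hv₂P⟩ := Subtype.ext (by rw [hXapply, Submodule.coe_smul, hXv₂])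
  have hv₁' : (⟨v₁, hv₁P⟩ : ↥P) ≠ 0 := fun h => hv₁ (congrArg Subtype.val h)
  have hv₂' : (⟨v₂, hv₂P⟩ : ↥P) ≠ 0 := fun h => hv₂ (congrArg Subtype.val h)
  obtain ⟨c₀, c₁, c₂, u, φ, hφu, hpoly⟩ :=
    SymplecticThetaSix.exists_rankOne_polynomial hP3 X hne hv₁' hXv₁' hv₂' hXv₂'
  -- realise `c₀ + c₁ X + c₂ X²` by `Ze = c₀ T + c₁ [B,C] + c₂ [BCB, C] ∈ 𝔊`
  set Ze : Module.End ℂ M := c₀ • T + c₁ • (B * C - C * B) + c₂ • (B * C * B * C - C * (B * C * B)) with hZe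
  have hZe𝔊 : Ze ∈ 𝔊 :=
    Submodule.add_mem _ (Submodule.add_mem _ (Submodule.smul_mem _ _ hT𝔊) (Submodule.smul_mem _ _ hZ₁))
      (Submodule.smul_mem _ _ hZ₂)
  have hZep : ∀ (p : M) (hp : p ∈ P), Ze p = c₀ • p + c₁ • B (C p) + c₂ • B (C (B (C p))) := by
    intro p hp
    rw [hZe]
    simp only [LinearMap.add_apply, LinearMap.smul_apply, LinearMap.sub_apply, Module.End.mul_apply, hP p hp,
      hBP p hp, map_zero, sub_zero]
  obtain ⟨ξ, hξQ, hξ⟩ := SymplecticThetaSix.exists_repr_dual ω hdetP hdetQ φ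
  have hZea : ∀ p ∈ P, Ze p = ω p ξ • (u : M) := by
    intro p hp
    have h := congrArg (fun A : Module.End ℂ ↥P => ((A ⟨p, hp⟩ : ↥P) : M)) hpoly
    simp only [LinearMap.add_apply, LinearMap.smul_apply, Module.End.one_apply, Module.End.mul_apply,
      LinearMap.smulRight_apply, Submodule.coe_add, Submodule.coe_smul, hXapply] at h
    rw [hZep p hp, h, ← hξ ⟨p, hp⟩]
  have hZeP : ∀ p ∈ P, Ze p ∈ P := fun p hp => by rw [hZea p hp]; exact Submodule.smul_mem _ _ u.2
  have haξ : ω (u : M) ξ = 1 := by rw [hξ u, hφu]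
  exact SymplecticThetaSix.core_of_rankOne ω hωnd hωalt 𝔊 hbr hskew hT𝔊 hTT hP hQ hPmem hQmem hirr hZe𝔊 hZeP
    u.2 hξQ haξ hZea

end TwoEigenvalues

end HodgeStructure

end Literature.AlgebraicGeometry.Motives

end
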